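import Literature.Topology.FourManifolds.LeeRasmussenMergeCanonicalProofs
import HarnessLib

/-!
# The split map of a connected sum of Gauss diagrams

Companion of `KhConnSumMerge` (the merge map `m : C(G) ⊗ C(H) → C(G # H)`). For Gauss diagrams
`G`, `H` (at least one chord each) the **split map**

  `Δ : C(G # H) → C(G) ⊗ C(H)`

of the cube complexes over the Frobenius system `A = R[X]/(X² - hX - t)` is the map induced by the
*inverse* saddle cobordism, from the connected sum `D₁ # D₂` back to the split union `D₁ ⊔ D₂`, at
the band where the connected sum was made: on enhanced states it keeps the states and the labels
off the base circle and comultiplies the label of the glued base circle of `G # H` into the labels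
of the two base circles of the blocks (`splitEntry`, written with the abstract split incidence
number `KhFace.splitInc` of `KhFaces` along the surgery relation `GaussDiagram.connSum_surg` of
`KhConnSumStates`; `Δ(1) = 1 ⊗ X + X ⊗ 1 - h 1 ⊗ 1`, `Δ(X) = X ⊗ X + t 1 ⊗ 1`). Exactly dual to
`mergeEntry`, which uses the multiplication. Since the tree has no tensor product of complexes,
`Δ` is recorded as a family of linear maps
`splitMap k i j : Cᵏ(G # H) → (functions on pairs of enhanced states of degrees i, j)`
(meaningful for `k = i + j`, zero otherwise), an element of `Cⁱ(G) ⊗ Cʲ(H)` being a function on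
pairs of basis vectors.

Main results:

* `sum_incidence_mul_splitEntry` — **`Δ` is a chain map**, entrywise:
  `Σ_{u'} ⟨d u, u'⟩ Δ(u'; s₁', s₂') = Σ_{s₁} Δ(u; s₁, s₂') ⟨d s₁, s₁'⟩ + (-1)^{|σ₁'|} Σ_{s₂} Δ(u; s₁', s₂) ⟨d s₂, s₂'⟩`
  under the merge/split dichotomy for `G` and `H` (the unsigned identity is the abstract face
  theorem `KhFace.face_comm` for the face "split the base circle / flip a chord", the Koszul signs
  are `edgeSign_append_castAdd/natAdd`); linear form `khovanovD_splitMap`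
  (`Δ ∘ d = (d ⊗ 1 + (-1)^{deg} 1 ⊗ d) ∘ Δ`);
* degrees (`§ Degrees`): `Δ` is homogeneous of homological degree `0`
  (`homDegree_eq_of_splitEntry_ne_zero`) and, in Lee's system `h = 0`, **filtered of quantum
  degree `-1`** (`qDegree_le_of_splitEntry_ne_zero`, `qDegree_add_ge_of_splitMap_ne_zero`,
  `le_qMin_splitMap_apply`): `χ = -1` for the saddle;
* Lee theory (`§ LeeCoord`, `§ Canonical`; `(R, h, t) = (ℚ, 0, 1)`): the Lee coordinates of
  `Δ z` on pairs are `2 ⟨z, glue u₁ u₂⟩` on pairs of monomials agreeing on the base arcs and `0`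
  otherwise (`leeCoord₂_splitMap`: `Δ 𝐚 = 𝐚 ⊗ 𝐚`, `Δ 𝐛 = 𝐛 ⊗ 𝐛` read through the orthogonality
  `Mᵀ M = 2`); hence **Rasmussen's Prop. 4.1 for the split map, exact form**: on the dual canonical
  generators `ŝ_u = (leeCoord 0)⁻¹ e_u`, `Δ(ŝ_{glue u₁ u₂}) = 2 · ŝ_{u₁} ⊗ ŝ_{u₂}`
  (`splitMap_leeCoord_symm_single`), `Δ(ŝ_t(G # H)) = 2 · ŝ_t(G) ⊗ ŝ_t(H)` (`splitMap_leeState₀`),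
  and in Lee's own normalisation `Δ(𝐬_t(G # H)) = 𝐬_t(G) ⊗ 𝐬_t(H)` on the nose
  (`splitMap_leeBasis_leeState₀`).

With the merge map this is the second half of the saddle calculus behind the additivity
`s(K₁ # K₂) = s(K₁) + s(K₂)` (Rasmussen (2010), Prop. 3.11), whose tree proof
(`rasmussenInvariant_connSum`) had to take a detour through mirror images for want of `Δ`.
Everything is proved; no named fact is introduced.

## References

* M. Khovanov, *A categorification of the Jones polynomial*, Duke Math. J. 101 (2000), §2.2
  (the algebra `A`, `Δ`), §7.4 (connected sum: `C(D₁ # D₂)` versus `C(D₁) ⊗ C(D₂)`).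
  [cite: Khovanov2000, §7.4]
* J. Rasmussen, *Khovanov homology and the slice genus*, Invent. Math. 182 (2010) 419–447
  (arXiv:math/0402131), §4.1–4.2 (maps of elementary cobordisms, filtered of degree `χ`),
  Prop. 4.1 (canonical generators go to nonzero multiples of canonical generators), Lemma 3.8,
  Prop. 3.11. [cite: Rasmussen2010, Prop. 4.1]
* E. S. Lee, *An endomorphism of the Khovanov invariant*, Adv. Math. 197 (2005) 554–586, §4
  (`Δ 𝐚 = 𝐚 ⊗ 𝐚`, `Δ 𝐛 = 𝐛 ⊗ 𝐛`). [cite: Lee2005, §4]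
* D. Bar-Natan, *On Khovanov's categorification of the Jones polynomial*, Algebr. Geom. Topol. 2
  (2002), §3.2 (gradings, signs). [cite: BarNatan2002, §3.2]

## Design notes

Hypotheses `0 < G.n`, `0 < H.n` (needed by `GaussDiagram.arcEquiv`) are carried throughout, as in
`KhConnSumMerge`, whose block calculus (`edgeVal_connSum_castAdd/natAdd`, `KhFace.labSumEquiv`, …)
is reused. The target of `splitMap k i j` is the function space
`G.degStates i → H.degStates j → R` (coefficients on pairs of basis vectors `s₁ ⊗ s₂`); the tensor
differential is written out as `d ⊗ 1` acting on the first variable and `1 ⊗ d` on the second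
(`khovanovD_splitMap`), and the Lee coordinates of such a function are taken in each variable
(`leeCoord₂`, the tensor square of `leeCoord 0`).
-/

open Function Finset

noncomputable section

namespace Literature.Topology.FourManifolds

namespace GaussDiagram

variable (G H : GaussDiagram) (hG : 0 < G.n) (hH : 0 < H.n)

/-! ## The split map: entries -/

section Split

variable {R : Type} [CommRing R] (h t : R)

/-- **The entries of the split map** `Δ : C(G # H) → C(G) ⊗ C(H)` on enhanced states: zero unless
the state of `u` is the pair of states of `s₁`, `s₂`, and then the abstract split incidence number
of `KhFaces` — the labels of `s₁`, `s₂` agree with those of `u` off the glued base circle of `u`,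
and the labels of the two base circles come with the structure constant
`splitCoeff (label of the glued circle) (label of the base circle of s₁) (label of the base circle of s₂)`
of the comultiplication `Δ(1) = 1 ⊗ X + X ⊗ 1 - h 1 ⊗ 1`, `Δ(X) = X ⊗ X + t 1 ⊗ 1` of
`A = R[X]/(X² - hX - t)`. This is the map induced by the saddle from `D₁ # D₂` to `D₁ ⊔ D₂`
(Khovanov (2000), §7.4; Rasmussen (2010), §4.1), dual to `mergeEntry`. [cite: Khovanov2000, §7.4] -/
def splitEntry (u : (G.connSum H).EnhancedState) (s₁ : G.EnhancedState) (s₂ : H.EnhancedState) : R :=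
  if u.state = Fin.append s₁.state s₂.state then
    KhFace.splitInc R h t ((G.connSum H).circleOf u.state ∘ G.arcEquiv H hG hH)
      (u.label ∘ G.arcEquiv H hG hH) (Sum.elim s₁.label s₂.label) (Sum.inl G.baseArc) (Sum.inr H.baseArc)
  else 0

/-- Entries of the split map vanish off the paired state. [folklore] -/
theorem splitEntry_of_ne {u : (G.connSum H).EnhancedState} {s₁ : G.EnhancedState} {s₂ : H.EnhancedState}
    (hu : u.state ≠ Fin.append s₁.state s₂.state) : G.splitEntry H hG hH h t u s₁ s₂ = 0 :=
  if_neg hu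

/-- Entries of the split map over the paired state. [folklore] -/
theorem splitEntry_of_eq {u : (G.connSum H).EnhancedState} {s₁ : G.EnhancedState} {s₂ : H.EnhancedState}
    (hu : u.state = Fin.append s₁.state s₂.state) :
    G.splitEntry H hG hH h t u s₁ s₂ =
      KhFace.splitInc R h t ((G.connSum H).circleOf u.state ∘ G.arcEquiv H hG hH)
        (u.label ∘ G.arcEquiv H hG hH) (Sum.elim s₁.label s₂.label) (Sum.inl G.baseArc) (Sum.inr H.baseArc) :=
  if_pos hu

/-- A nonzero entry of the split map sits over the paired state. [folklore] -/
theorem state_eq_of_splitEntry_ne_zero {u : (G.connSum H).EnhancedState} {s₁ : G.EnhancedState}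
    {s₂ : H.EnhancedState} (hu : G.splitEntry H hG hH h t u s₁ s₂ ≠ 0) :
    u.state = Fin.append s₁.state s₂.state := by
  by_contra hne
  exact hu (G.splitEntry_of_ne H hG hH h t hne)

end Split

/-! ## The split map is a chain map -/

section ChainMap

variable {R : Type} [CommRing R] (h t : R)

/-- **Co-Leibniz rule, first block.** For a flip of a chord `i` of `G` (state `σ₁`, `σ₁ i = 0`),
an enhanced state `u` of `G # H` over `(σ₁, σ₂)` and targets `s₁'` over `σ₁[i ↦ 1]`, `s₂'` over
`σ₂`: `Σ_{u'} ⟨d u, u'⟩ Δ(u'; s₁', s₂') = Σ_{s₁} Δ(u; s₁, s₂') ⟨d s₁, s₁'⟩`. The unsigned identity is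
the abstract face theorem for the face "split the base circle, flip the chord `i`"
(`KhFace.face_comm`, kinds split/flip); the Koszul signs agree (`edgeSign_append_castAdd`).
Khovanov (2000), Prop. 8, §7.4. [cite: Khovanov2000, §7.4] -/
theorem sum_incidence_mul_splitEntry_castAdd
    (hms₁ : ∀ (σ : G.State) (k : Fin G.n), σ k = false → G.IsMergeAt σ k ∨ G.IsSplitAt σ k)
    (hms₂ : ∀ (σ : H.State) (k : Fin H.n), σ k = false → H.IsMergeAt σ k ∨ H.IsSplitAt σ k)
    (u : (G.connSum H).EnhancedState) (s₁' : G.EnhancedState) (s₂' : H.EnhancedState)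
    {σ₁ : G.State} {i : Fin G.n} (hi : σ₁ i = false) (hu : u.state = Fin.append σ₁ s₂'.state)
    (hs₁' : s₁'.state = Function.update σ₁ i true) :
    ∑ u', (G.connSum H).incidence R h t u u' * G.splitEntry H hG hH h t u' s₁' s₂' =
      ∑ s₁, G.splitEntry H hG hH h t u s₁ s₂' * G.incidence R h t s₁ s₁' := by
  classical
  obtain ⟨τ, lab, hlab⟩ := u
  obtain ⟨σ₁', la₁, hla₁⟩ := s₁'
  obtain ⟨σ₂, la₂, hla₂⟩ := s₂'
  simp only at hu hs₁'
  subst hu hs₁'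
  have hτi : (Fin.append σ₁ σ₂ : (G.connSum H).State) (Fin.castAdd H.n i) = false := by simp [hi]
  have hupd : (Fin.append (Function.update σ₁ i true) σ₂ : (G.connSum H).State) =
      Function.update (Fin.append σ₁ σ₂) (Fin.castAdd H.n i) true :=
    G.append_update_left H σ₁ σ₂ i true
  have hmsτ : (G.connSum H).IsMergeAt (Fin.append σ₁ σ₂) (Fin.castAdd H.n i) ∨
      (G.connSum H).IsSplitAt (Fin.append σ₁ σ₂) (Fin.castAdd H.n i) :=
    G.dichotomy_connSum H hG hH hms₁ hms₂ _ _ hτi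
  -- the labellings of the face
  have hlabL : ∀ x y, (G.connSum H).circleOf (Fin.append σ₁ σ₂) x =
      (G.connSum H).circleOf (Fin.append σ₁ σ₂) y → lab x = lab y := fun x y hxy ↦
    (⟨_, lab, hlab⟩ : (G.connSum H).EnhancedState).label_eq_of_circleOf_eq hxy
  have hlab' : ∀ x y, ((G.connSum H).circleOf (Fin.append σ₁ σ₂) ∘ G.arcEquiv H hG hH) x =
      ((G.connSum H).circleOf (Fin.append σ₁ σ₂) ∘ G.arcEquiv H hG hH) y →
      (lab ∘ G.arcEquiv H hG hH) x = (lab ∘ G.arcEquiv H hG hH) y := fun x y hxy ↦ hlabL _ _ hxy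
  have hnu : ∀ x y, Sum.map (G.circleOf (Function.update σ₁ i true)) (H.circleOf σ₂) x =
      Sum.map (G.circleOf (Function.update σ₁ i true)) (H.circleOf σ₂) y →
      Sum.elim la₁ la₂ x = Sum.elim la₁ la₂ y := by
    rintro (x | x) (y | y) hxy
    · exact (⟨_, la₁, hla₁⟩ : G.EnhancedState).label_eq_of_circleOf_eq (by simpa using hxy)
    · simp at hxy
    · simp at hxy
    · exact (⟨σ₂, la₂, hla₂⟩ : H.EnhancedState).label_eq_of_circleOf_eq (by simpa using hxy)
  have hla₂' : ∀ x y, H.circleOf σ₂ x = H.circleOf σ₂ y → la₂ x = la₂ y := fun x y hxy ↦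
    (⟨σ₂, la₂, hla₂⟩ : H.EnhancedState).label_eq_of_circleOf_eq hxy
  -- ### Left-hand side: only `u'` over `(σ₁[i ↦ 1], σ₂)` contribute
  have hL1 : ∀ u' : (G.connSum H).EnhancedState,
      (G.connSum H).incidence R h t ⟨_, lab, hlab⟩ u' *
        G.splitEntry H hG hH h t u' ⟨_, la₁, hla₁⟩ ⟨σ₂, la₂, hla₂⟩ =
      if u'.state = Fin.append (Function.update σ₁ i true) σ₂ then
        (G.connSum H).incidence R h t ⟨_, lab, hlab⟩ u' *
          G.splitEntry H hG hH h t u' ⟨_, la₁, hla₁⟩ ⟨σ₂, la₂, hla₂⟩ else 0 := by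
    intro u'
    split_ifs with hu'
    · rfl
    · rw [G.splitEntry_of_ne H hG hH h t hu', mul_zero]
  have hL2 : ∀ nu : KhFace.Lab ((G.connSum H).circleOf (Fin.append (Function.update σ₁ i true) σ₂)),
      (G.connSum H).incidence R h t ⟨_, lab, hlab⟩ ((G.connSum H).ofLab _ nu) *
        G.splitEntry H hG hH h t ((G.connSum H).ofLab _ nu) ⟨_, la₁, hla₁⟩ ⟨σ₂, la₂, hla₂⟩ =
      (edgeSign σ₁ i : R) *
        (KhFace.edgeVal R h t ((G.connSum H).kindAt (Fin.append σ₁ σ₂) (Fin.castAdd H.n i))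
            ((G.connSum H).circleOf (Fin.append σ₁ σ₂) ∘ G.arcEquiv H hG hH)
            ((G.connSum H).circleOf (Fin.append (Function.update σ₁ i true) σ₂) ∘ G.arcEquiv H hG hH)
            (lab ∘ G.arcEquiv H hG hH) (nu.1 ∘ G.arcEquiv H hG hH)
            (Sum.inl (G.arcIn (G.overPos i))) (Sum.inl (G.arcOut (G.overPos i))) *
          KhFace.edgeVal R h t KhFace.Kind.split
            ((G.connSum H).circleOf (Fin.append (Function.update σ₁ i true) σ₂) ∘ G.arcEquiv H hG hH)
            (Sum.map (G.circleOf (Function.update σ₁ i true)) (H.circleOf σ₂))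
            (nu.1 ∘ G.arcEquiv H hG hH) (Sum.elim la₁ la₂) (Sum.inl G.baseArc) (Sum.inr H.baseArc)) := by
    intro nu
    rw [incidence_eq_edgeVal h t (s := ⟨_, lab, hlab⟩) (x := (G.connSum H).ofLab _ nu)
        (i := Fin.castAdd H.n i) hmsτ hτi hupd]
    dsimp only [ofLab]
    rw [G.edgeVal_connSum_castAdd H hG hH σ₁ σ₂ h t _ ⟨lab, hlabL⟩ nu, edgeSign_append_castAdd,
      splitEntry, if_pos rfl, KhFace.edgeVal_split]
    ring
  rw [Finset.sum_congr rfl (fun u' _ ↦ hL1 u'), sum_ite_state_eq,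
    Finset.sum_congr rfl (fun nu _ ↦ hL2 nu), ← Finset.mul_sum]
  -- reindex the labellings of `G # H` by labellings read on blocks, and apply the face theorem
  have hre := Fintype.sum_equiv (KhFace.labEquiv (G.arcEquiv H hG hH)
      ((G.connSum H).circleOf (Fin.append (Function.update σ₁ i true) σ₂))).symm
    (fun nu : KhFace.Lab ((G.connSum H).circleOf (Fin.append (Function.update σ₁ i true) σ₂)) ↦
      KhFace.edgeVal R h t ((G.connSum H).kindAt (Fin.append σ₁ σ₂) (Fin.castAdd H.n i))
          ((G.connSum H).circleOf (Fin.append σ₁ σ₂) ∘ G.arcEquiv H hG hH)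
          ((G.connSum H).circleOf (Fin.append (Function.update σ₁ i true) σ₂) ∘ G.arcEquiv H hG hH)
          (lab ∘ G.arcEquiv H hG hH) (nu.1 ∘ G.arcEquiv H hG hH)
          (Sum.inl (G.arcIn (G.overPos i))) (Sum.inl (G.arcOut (G.overPos i))) *
        KhFace.edgeVal R h t KhFace.Kind.split
          ((G.connSum H).circleOf (Fin.append (Function.update σ₁ i true) σ₂) ∘ G.arcEquiv H hG hH)
          (Sum.map (G.circleOf (Function.update σ₁ i true)) (H.circleOf σ₂))
          (nu.1 ∘ G.arcEquiv H hG hH) (Sum.elim la₁ la₂) (Sum.inl G.baseArc) (Sum.inr H.baseArc))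
    (fun mu ↦
      KhFace.edgeVal R h t ((G.connSum H).kindAt (Fin.append σ₁ σ₂) (Fin.castAdd H.n i))
          ((G.connSum H).circleOf (Fin.append σ₁ σ₂) ∘ G.arcEquiv H hG hH)
          ((G.connSum H).circleOf (Fin.append (Function.update σ₁ i true) σ₂) ∘ G.arcEquiv H hG hH)
          (lab ∘ G.arcEquiv H hG hH) mu.1
          (Sum.inl (G.arcIn (G.overPos i))) (Sum.inl (G.arcOut (G.overPos i))) *
        KhFace.edgeVal R h t KhFace.Kind.split
          ((G.connSum H).circleOf (Fin.append (Function.update σ₁ i true) σ₂) ∘ G.arcEquiv H hG hH)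
          (Sum.map (G.circleOf (Function.update σ₁ i true)) (H.circleOf σ₂))
          mu.1 (Sum.elim la₁ la₂) (Sum.inl G.baseArc) (Sum.inr H.baseArc))
    (fun nu ↦ rfl)
  have hface := KhFace.face_comm (R := R) (h := h) (t := t) KhFace.Kind.split (G.kindAt σ₁ i)
    ((G.connSum H).kindAt (Fin.append σ₁ σ₂) (Fin.castAdd H.n i)) KhFace.Kind.split
    (G.connSum_surg H σ₁ σ₂ hG hH)
    ((edgeOK_kindAt (hms₁ σ₁ i hi) rfl).sumMap_left (H.circleOf σ₂))
    (G.edgeOK_connSum_castAdd H hG hH σ₁ σ₂ hmsτ)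
    (G.connSum_surg H (Function.update σ₁ i true) σ₂ hG hH)
    ⟨lab ∘ G.arcEquiv H hG hH, hlab'⟩ ⟨Sum.elim la₁ la₂, hnu⟩
  rw [hre, ← hface]
  -- ### Right-hand side: only `s₁` over `σ₁` contribute
  have hR1 : ∀ s₁ : G.EnhancedState,
      G.splitEntry H hG hH h t ⟨_, lab, hlab⟩ s₁ ⟨σ₂, la₂, hla₂⟩ * G.incidence R h t s₁ ⟨_, la₁, hla₁⟩ =
      if s₁.state = σ₁ then
        G.splitEntry H hG hH h t ⟨_, lab, hlab⟩ s₁ ⟨σ₂, la₂, hla₂⟩ * G.incidence R h t s₁ ⟨_, la₁, hla₁⟩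
      else 0 := by
    intro s₁
    split_ifs with hs
    · rfl
    · rw [G.splitEntry_of_ne H hG hH h t, zero_mul]
      intro hst
      exact hs (G.append_left_cancel H hst).symm
  have hR2 : ∀ mu₁ : KhFace.Lab (G.circleOf σ₁),
      G.splitEntry H hG hH h t ⟨_, lab, hlab⟩ (G.ofLab _ mu₁) ⟨σ₂, la₂, hla₂⟩ *
        G.incidence R h t (G.ofLab _ mu₁) ⟨_, la₁, hla₁⟩ =
      (edgeSign σ₁ i : R) *
        (KhFace.splitInc R h t ((G.connSum H).circleOf (Fin.append σ₁ σ₂) ∘ G.arcEquiv H hG hH)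
            (lab ∘ G.arcEquiv H hG hH) (Sum.elim mu₁.1 la₂) (Sum.inl G.baseArc) (Sum.inr H.baseArc) *
          KhFace.edgeVal R h t (G.kindAt σ₁ i) (G.circleOf σ₁) (G.circleOf (Function.update σ₁ i true))
            mu₁.1 la₁ (G.arcIn (G.overPos i)) (G.arcOut (G.overPos i))) := by
    intro mu₁
    rw [incidence_eq_edgeVal h t (s := G.ofLab _ mu₁) (x := ⟨_, la₁, hla₁⟩) (i := i)
      (hms₁ σ₁ i hi) hi rfl]
    dsimp only [ofLab]
    rw [splitEntry, if_pos rfl]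
    ring
  rw [Finset.sum_congr rfl (fun s _ ↦ hR1 s), sum_ite_state_eq,
    Finset.sum_congr rfl (fun mu _ ↦ hR2 mu), ← Finset.mul_sum]
  congr 1
  -- ### The face sum over labellings of `(σ₁, σ₂)` in `G ⊔ H` collapses to labellings of `σ₁`
  rw [Fintype.sum_equiv (KhFace.labSumEquiv (G.circleOf σ₁) (H.circleOf σ₂)) _
    (fun p ↦ KhFace.edgeVal R h t KhFace.Kind.split
        ((G.connSum H).circleOf (Fin.append σ₁ σ₂) ∘ G.arcEquiv H hG hH)
        (Sum.map (G.circleOf σ₁) (H.circleOf σ₂)) (lab ∘ G.arcEquiv H hG hH)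
        (Sum.elim p.1.1 p.2.1) (Sum.inl G.baseArc) (Sum.inr H.baseArc) *
      KhFace.edgeVal R h t (G.kindAt σ₁ i) (Sum.map (G.circleOf σ₁) (H.circleOf σ₂))
        (Sum.map (G.circleOf (Function.update σ₁ i true)) (H.circleOf σ₂))
        (Sum.elim p.1.1 p.2.1) (Sum.elim la₁ la₂)
        (Sum.inl (G.arcIn (G.overPos i))) (Sum.inl (G.arcOut (G.overPos i))))
    (fun mu ↦ by simp only [KhFace.labSumEquiv, Equiv.coe_fn_mk, Sum.elim_comp_inl_inr]),
    Fintype.sum_prod_type]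
  refine Finset.sum_congr rfl fun mu₁ _ ↦ ?_
  simp only [KhFace.edgeVal_sumMap_left, KhFace.edgeVal_split, mul_ite, mul_zero]
  rw [Finset.sum_eq_single (⟨la₂, hla₂'⟩ : KhFace.Lab (H.circleOf σ₂))]
  · rw [if_pos rfl]
  · intro mu₂ _ hne
    rw [if_neg (fun h' ↦ hne (Subtype.ext h'.symm))]
  · intro h'
    exact absurd (Finset.mem_univ _) h'

/-- **Co-Leibniz rule, second block.** For a flip of a chord `j` of `H` (state `σ₂`, `σ₂ j = 0`),
an enhanced state `u` of `G # H` over `(σ₁, σ₂)` and targets `s₁'` over `σ₁`, `s₂'` over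
`σ₂[j ↦ 1]`: `Σ_{u'} ⟨d u, u'⟩ Δ(u'; s₁', s₂') = (-1)^{|σ₁|} Σ_{s₂} Δ(u; s₁', s₂) ⟨d s₂, s₂'⟩`; the sign
is the Koszul sign of the tensor product (`edgeSign_append_natAdd`). Khovanov (2000), Prop. 8, §7.4.
[cite: Khovanov2000, §7.4] -/
theorem sum_incidence_mul_splitEntry_natAdd
    (hms₁ : ∀ (σ : G.State) (k : Fin G.n), σ k = false → G.IsMergeAt σ k ∨ G.IsSplitAt σ k)
    (hms₂ : ∀ (σ : H.State) (k : Fin H.n), σ k = false → H.IsMergeAt σ k ∨ H.IsSplitAt σ k)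
    (u : (G.connSum H).EnhancedState) (s₁' : G.EnhancedState) (s₂' : H.EnhancedState)
    {σ₂ : H.State} {j : Fin H.n} (hj : σ₂ j = false) (hu : u.state = Fin.append s₁'.state σ₂)
    (hs₂' : s₂'.state = Function.update σ₂ j true) :
    ∑ u', (G.connSum H).incidence R h t u u' * G.splitEntry H hG hH h t u' s₁' s₂' =
      (-1) ^ s₁'.state.weight * ∑ s₂, G.splitEntry H hG hH h t u s₁' s₂ * H.incidence R h t s₂ s₂' := by
  classical
  obtain ⟨τ, lab, hlab⟩ := u
  obtain ⟨σ₁, la₁, hla₁⟩ := s₁'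
  obtain ⟨σ₂', la₂, hla₂⟩ := s₂'
  simp only at hu hs₂'
  subst hu hs₂'
  have hτj : (Fin.append σ₁ σ₂ : (G.connSum H).State) (Fin.natAdd G.n j) = false := by simp [hj]
  have hupd : (Fin.append σ₁ (Function.update σ₂ j true) : (G.connSum H).State) =
      Function.update (Fin.append σ₁ σ₂) (Fin.natAdd G.n j) true :=
    G.append_update_right H σ₁ σ₂ j true
  have hmsτ : (G.connSum H).IsMergeAt (Fin.append σ₁ σ₂) (Fin.natAdd G.n j) ∨
      (G.connSum H).IsSplitAt (Fin.append σ₁ σ₂) (Fin.natAdd G.n j) :=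
    G.dichotomy_connSum H hG hH hms₁ hms₂ _ _ hτj
  -- the labellings of the face
  have hlabL : ∀ x y, (G.connSum H).circleOf (Fin.append σ₁ σ₂) x =
      (G.connSum H).circleOf (Fin.append σ₁ σ₂) y → lab x = lab y := fun x y hxy ↦
    (⟨_, lab, hlab⟩ : (G.connSum H).EnhancedState).label_eq_of_circleOf_eq hxy
  have hlab' : ∀ x y, ((G.connSum H).circleOf (Fin.append σ₁ σ₂) ∘ G.arcEquiv H hG hH) x =
      ((G.connSum H).circleOf (Fin.append σ₁ σ₂) ∘ G.arcEquiv H hG hH) y →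
      (lab ∘ G.arcEquiv H hG hH) x = (lab ∘ G.arcEquiv H hG hH) y := fun x y hxy ↦ hlabL _ _ hxy
  have hnu : ∀ x y, Sum.map (G.circleOf σ₁) (H.circleOf (Function.update σ₂ j true)) x =
      Sum.map (G.circleOf σ₁) (H.circleOf (Function.update σ₂ j true)) y →
      Sum.elim la₁ la₂ x = Sum.elim la₁ la₂ y := by
    rintro (x | x) (y | y) hxy
    · exact (⟨σ₁, la₁, hla₁⟩ : G.EnhancedState).label_eq_of_circleOf_eq (by simpa using hxy)
    · simp at hxy
    · simp at hxy
    · exact (⟨_, la₂, hla₂⟩ : H.EnhancedState).label_eq_of_circleOf_eq (by simpa using hxy)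
  have hla₁' : ∀ x y, G.circleOf σ₁ x = G.circleOf σ₁ y → la₁ x = la₁ y := fun x y hxy ↦
    (⟨σ₁, la₁, hla₁⟩ : G.EnhancedState).label_eq_of_circleOf_eq hxy
  -- ### Left-hand side: only `u'` over `(σ₁, σ₂[j ↦ 1])` contribute
  have hL1 : ∀ u' : (G.connSum H).EnhancedState,
      (G.connSum H).incidence R h t ⟨_, lab, hlab⟩ u' *
        G.splitEntry H hG hH h t u' ⟨σ₁, la₁, hla₁⟩ ⟨_, la₂, hla₂⟩ =
      if u'.state = Fin.append σ₁ (Function.update σ₂ j true) then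
        (G.connSum H).incidence R h t ⟨_, lab, hlab⟩ u' *
          G.splitEntry H hG hH h t u' ⟨σ₁, la₁, hla₁⟩ ⟨_, la₂, hla₂⟩ else 0 := by
    intro u'
    split_ifs with hu'
    · rfl
    · rw [G.splitEntry_of_ne H hG hH h t hu', mul_zero]
  have hL2 : ∀ nu : KhFace.Lab ((G.connSum H).circleOf (Fin.append σ₁ (Function.update σ₂ j true))),
      (G.connSum H).incidence R h t ⟨_, lab, hlab⟩ ((G.connSum H).ofLab _ nu) *
        G.splitEntry H hG hH h t ((G.connSum H).ofLab _ nu) ⟨σ₁, la₁, hla₁⟩ ⟨_, la₂, hla₂⟩ =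
      ((-1) ^ σ₁.weight * edgeSign σ₂ j : R) *
        (KhFace.edgeVal R h t ((G.connSum H).kindAt (Fin.append σ₁ σ₂) (Fin.natAdd G.n j))
            ((G.connSum H).circleOf (Fin.append σ₁ σ₂) ∘ G.arcEquiv H hG hH)
            ((G.connSum H).circleOf (Fin.append σ₁ (Function.update σ₂ j true)) ∘ G.arcEquiv H hG hH)
            (lab ∘ G.arcEquiv H hG hH) (nu.1 ∘ G.arcEquiv H hG hH)
            (Sum.inr (H.arcIn (H.overPos j))) (Sum.inr (H.arcOut (H.overPos j))) *
          KhFace.edgeVal R h t KhFace.Kind.split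
            ((G.connSum H).circleOf (Fin.append σ₁ (Function.update σ₂ j true)) ∘ G.arcEquiv H hG hH)
            (Sum.map (G.circleOf σ₁) (H.circleOf (Function.update σ₂ j true)))
            (nu.1 ∘ G.arcEquiv H hG hH) (Sum.elim la₁ la₂) (Sum.inl G.baseArc) (Sum.inr H.baseArc)) := by
    intro nu
    rw [incidence_eq_edgeVal h t (s := ⟨_, lab, hlab⟩) (x := (G.connSum H).ofLab _ nu)
        (i := Fin.natAdd G.n j) hmsτ hτj hupd]
    dsimp only [ofLab]
    rw [G.edgeVal_connSum_natAdd H hG hH σ₁ σ₂ h t _ ⟨lab, hlabL⟩ nu, edgeSign_append_natAdd,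
      splitEntry, if_pos rfl, KhFace.edgeVal_split]
    push_cast
    ring
  rw [Finset.sum_congr rfl (fun u' _ ↦ hL1 u'), sum_ite_state_eq,
    Finset.sum_congr rfl (fun nu _ ↦ hL2 nu), ← Finset.mul_sum]
  -- reindex the labellings of `G # H` by labellings read on blocks, and apply the face theorem
  have hre := Fintype.sum_equiv (KhFace.labEquiv (G.arcEquiv H hG hH)
      ((G.connSum H).circleOf (Fin.append σ₁ (Function.update σ₂ j true)))).symm
    (fun nu : KhFace.Lab ((G.connSum H).circleOf (Fin.append σ₁ (Function.update σ₂ j true))) ↦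
      KhFace.edgeVal R h t ((G.connSum H).kindAt (Fin.append σ₁ σ₂) (Fin.natAdd G.n j))
          ((G.connSum H).circleOf (Fin.append σ₁ σ₂) ∘ G.arcEquiv H hG hH)
          ((G.connSum H).circleOf (Fin.append σ₁ (Function.update σ₂ j true)) ∘ G.arcEquiv H hG hH)
          (lab ∘ G.arcEquiv H hG hH) (nu.1 ∘ G.arcEquiv H hG hH)
          (Sum.inr (H.arcIn (H.overPos j))) (Sum.inr (H.arcOut (H.overPos j))) *
        KhFace.edgeVal R h t KhFace.Kind.split
          ((G.connSum H).circleOf (Fin.append σ₁ (Function.update σ₂ j true)) ∘ G.arcEquiv H hG hH)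
          (Sum.map (G.circleOf σ₁) (H.circleOf (Function.update σ₂ j true)))
          (nu.1 ∘ G.arcEquiv H hG hH) (Sum.elim la₁ la₂) (Sum.inl G.baseArc) (Sum.inr H.baseArc))
    (fun mu ↦
      KhFace.edgeVal R h t ((G.connSum H).kindAt (Fin.append σ₁ σ₂) (Fin.natAdd G.n j))
          ((G.connSum H).circleOf (Fin.append σ₁ σ₂) ∘ G.arcEquiv H hG hH)
          ((G.connSum H).circleOf (Fin.append σ₁ (Function.update σ₂ j true)) ∘ G.arcEquiv H hG hH)
          (lab ∘ G.arcEquiv H hG hH) mu.1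
          (Sum.inr (H.arcIn (H.overPos j))) (Sum.inr (H.arcOut (H.overPos j))) *
        KhFace.edgeVal R h t KhFace.Kind.split
          ((G.connSum H).circleOf (Fin.append σ₁ (Function.update σ₂ j true)) ∘ G.arcEquiv H hG hH)
          (Sum.map (G.circleOf σ₁) (H.circleOf (Function.update σ₂ j true)))
          mu.1 (Sum.elim la₁ la₂) (Sum.inl G.baseArc) (Sum.inr H.baseArc))
    (fun nu ↦ rfl)
  have hface := KhFace.face_comm (R := R) (h := h) (t := t) KhFace.Kind.split (H.kindAt σ₂ j)
    ((G.connSum H).kindAt (Fin.append σ₁ σ₂) (Fin.natAdd G.n j)) KhFace.Kind.split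
    (G.connSum_surg H σ₁ σ₂ hG hH)
    ((edgeOK_kindAt (hms₂ σ₂ j hj) rfl).sumMap_right (G.circleOf σ₁))
    (G.edgeOK_connSum_natAdd H hG hH σ₁ σ₂ hmsτ)
    (G.connSum_surg H σ₁ (Function.update σ₂ j true) hG hH)
    ⟨lab ∘ G.arcEquiv H hG hH, hlab'⟩ ⟨Sum.elim la₁ la₂, hnu⟩
  rw [hre, ← hface]
  -- ### Right-hand side: only `s₂` over `σ₂` contribute
  have hR1 : ∀ s₂ : H.EnhancedState,
      G.splitEntry H hG hH h t ⟨_, lab, hlab⟩ ⟨σ₁, la₁, hla₁⟩ s₂ * H.incidence R h t s₂ ⟨_, la₂, hla₂⟩ =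
      if s₂.state = σ₂ then
        G.splitEntry H hG hH h t ⟨_, lab, hlab⟩ ⟨σ₁, la₁, hla₁⟩ s₂ * H.incidence R h t s₂ ⟨_, la₂, hla₂⟩
      else 0 := by
    intro s₂
    split_ifs with hs
    · rfl
    · rw [G.splitEntry_of_ne H hG hH h t, zero_mul]
      intro hst
      exact hs (G.append_right_cancel H hst).symm
  have hR2 : ∀ mu₂ : KhFace.Lab (H.circleOf σ₂),
      G.splitEntry H hG hH h t ⟨_, lab, hlab⟩ ⟨σ₁, la₁, hla₁⟩ (H.ofLab _ mu₂) *
        H.incidence R h t (H.ofLab _ mu₂) ⟨_, la₂, hla₂⟩ =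
      (edgeSign σ₂ j : R) *
        (KhFace.splitInc R h t ((G.connSum H).circleOf (Fin.append σ₁ σ₂) ∘ G.arcEquiv H hG hH)
            (lab ∘ G.arcEquiv H hG hH) (Sum.elim la₁ mu₂.1) (Sum.inl G.baseArc) (Sum.inr H.baseArc) *
          KhFace.edgeVal R h t (H.kindAt σ₂ j) (H.circleOf σ₂) (H.circleOf (Function.update σ₂ j true))
            mu₂.1 la₂ (H.arcIn (H.overPos j)) (H.arcOut (H.overPos j))) := by
    intro mu₂
    rw [incidence_eq_edgeVal h t (s := H.ofLab _ mu₂) (x := ⟨_, la₂, hla₂⟩) (i := j)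
      (hms₂ σ₂ j hj) hj rfl]
    dsimp only [ofLab]
    rw [splitEntry, if_pos rfl]
    ring
  rw [Finset.sum_congr rfl (fun s _ ↦ hR1 s), sum_ite_state_eq,
    Finset.sum_congr rfl (fun mu _ ↦ hR2 mu), ← Finset.mul_sum, ← mul_assoc]
  push_cast
  congr 1
  -- ### The face sum over labellings of `(σ₁, σ₂)` in `G ⊔ H` collapses to labellings of `σ₂`
  rw [Fintype.sum_equiv (KhFace.labSumEquiv (G.circleOf σ₁) (H.circleOf σ₂)) _
    (fun p ↦ KhFace.edgeVal R h t KhFace.Kind.split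
        ((G.connSum H).circleOf (Fin.append σ₁ σ₂) ∘ G.arcEquiv H hG hH)
        (Sum.map (G.circleOf σ₁) (H.circleOf σ₂)) (lab ∘ G.arcEquiv H hG hH)
        (Sum.elim p.1.1 p.2.1) (Sum.inl G.baseArc) (Sum.inr H.baseArc) *
      KhFace.edgeVal R h t (H.kindAt σ₂ j) (Sum.map (G.circleOf σ₁) (H.circleOf σ₂))
        (Sum.map (G.circleOf σ₁) (H.circleOf (Function.update σ₂ j true)))
        (Sum.elim p.1.1 p.2.1) (Sum.elim la₁ la₂)
        (Sum.inr (H.arcIn (H.overPos j))) (Sum.inr (H.arcOut (H.overPos j))))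
    (fun mu ↦ by simp only [KhFace.labSumEquiv, Equiv.coe_fn_mk, Sum.elim_comp_inl_inr]),
    Fintype.sum_prod_type, Finset.sum_comm]
  refine Finset.sum_congr rfl fun mu₂ _ ↦ ?_
  simp only [KhFace.edgeVal_sumMap_right, KhFace.edgeVal_split, mul_ite, mul_zero]
  rw [Finset.sum_eq_single (⟨la₁, hla₁'⟩ : KhFace.Lab (G.circleOf σ₁))]
  · rw [if_pos rfl]
  · intro mu₁ _ hne
    rw [if_neg (fun h' ↦ hne (Subtype.ext h'.symm))]
  · intro h'
    exact absurd (Finset.mem_univ _) h'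

/-- `Fin.append` is injective in both arguments. [folklore] -/
theorem append_inj {σ₁ σ₁' : G.State} {σ₂ σ₂' : H.State}
    (e : (Fin.append σ₁ σ₂ : (G.connSum H).State) = Fin.append σ₁' σ₂') : σ₁ = σ₁' ∧ σ₂ = σ₂' := by
  refine ⟨funext fun i ↦ ?_, funext fun j ↦ ?_⟩
  · have := congrFun e (Fin.castAdd H.n i)
    rwa [Fin.append_left, Fin.append_left] at this
  · have := congrFun e (Fin.natAdd G.n j)
    rwa [Fin.append_right, Fin.append_right] at this

/-- **No flip, no contribution (left-hand side).** If `(s₁', s₂')` sits over neither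
`(σ₁[i ↦ 1], σ₂)` nor `(σ₁, σ₂[j ↦ 1])` for the state `(σ₁, σ₂)` of `u` and a `0`-smoothing, the
left-hand side of the co-Leibniz rule vanishes. [folklore] -/
theorem sum_incidence_mul_splitEntry_eq_zero (u : (G.connSum H).EnhancedState) (s₁' : G.EnhancedState)
    (s₂' : H.EnhancedState)
    (h₁ : ¬ ∃ (σ₁ : G.State) (i : Fin G.n), σ₁ i = false ∧ u.state = Fin.append σ₁ s₂'.state ∧
      s₁'.state = Function.update σ₁ i true)
    (h₂ : ¬ ∃ (σ₂ : H.State) (j : Fin H.n), σ₂ j = false ∧ u.state = Fin.append s₁'.state σ₂ ∧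
      s₂'.state = Function.update σ₂ j true) :
    ∑ u', (G.connSum H).incidence R h t u u' * G.splitEntry H hG hH h t u' s₁' s₂' = 0 := by
  refine Finset.sum_eq_zero fun u' _ ↦ ?_
  by_cases hinc : (G.connSum H).incidence R h t u u' = 0
  · rw [hinc, zero_mul]
  by_cases hm : G.splitEntry H hG hH h t u' s₁' s₂' = 0
  · rw [hm, mul_zero]
  exfalso
  have hst := G.state_eq_of_splitEntry_ne_zero H hG hH h t hm
  obtain ⟨k, hk, hu'⟩ := exists_of_incidence_ne_zero hinc
  have hρ := G.state_eq_append H u.state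
  induction k using Fin.addCases with
  | left i =>
    have h3 : u'.state = Fin.append (Function.update (fun i ↦ u.state (Fin.castAdd H.n i)) i true)
        (fun j ↦ u.state (Fin.natAdd G.n j)) := by
      rw [G.append_update_left H, ← hρ]; exact hu'
    obtain ⟨e₁, e₂⟩ := G.append_inj H (hst.symm.trans h3)
    refine h₁ ⟨_, i, hk, ?_, e₁⟩
    rw [e₂]; exact hρ
  | right j =>
    have h3 : u'.state = Fin.append (fun i ↦ u.state (Fin.castAdd H.n i))
        (Function.update (fun j ↦ u.state (Fin.natAdd G.n j)) j true) := by
      rw [G.append_update_right H, ← hρ]; exact hu'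
    obtain ⟨e₁, e₂⟩ := G.append_inj H (hst.symm.trans h3)
    refine h₂ ⟨_, j, hk, ?_, e₂⟩
    rw [e₁]; exact hρ

/-- No flip in `G`, no contribution of the first right-hand term. [folklore] -/
theorem sum_splitEntry_mul_incidence_left_eq_zero (u : (G.connSum H).EnhancedState)
    (s₁' : G.EnhancedState) (s₂' : H.EnhancedState)
    (h₁ : ¬ ∃ (σ₁ : G.State) (i : Fin G.n), σ₁ i = false ∧ u.state = Fin.append σ₁ s₂'.state ∧
      s₁'.state = Function.update σ₁ i true) :
    ∑ s₁, G.splitEntry H hG hH h t u s₁ s₂' * G.incidence R h t s₁ s₁' = 0 := by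
  refine Finset.sum_eq_zero fun s₁ _ ↦ ?_
  by_cases hm : G.splitEntry H hG hH h t u s₁ s₂' = 0
  · rw [hm, zero_mul]
  by_cases hinc : G.incidence R h t s₁ s₁' = 0
  · rw [hinc, mul_zero]
  exfalso
  obtain ⟨i, hi, hs₁'⟩ := exists_of_incidence_ne_zero hinc
  exact h₁ ⟨s₁.state, i, hi, G.state_eq_of_splitEntry_ne_zero H hG hH h t hm, hs₁'⟩

/-- No flip in `H`, no contribution of the second right-hand term. [folklore] -/
theorem sum_splitEntry_mul_incidence_right_eq_zero (u : (G.connSum H).EnhancedState)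
    (s₁' : G.EnhancedState) (s₂' : H.EnhancedState)
    (h₂ : ¬ ∃ (σ₂ : H.State) (j : Fin H.n), σ₂ j = false ∧ u.state = Fin.append s₁'.state σ₂ ∧
      s₂'.state = Function.update σ₂ j true) :
    ∑ s₂, G.splitEntry H hG hH h t u s₁' s₂ * H.incidence R h t s₂ s₂' = 0 := by
  refine Finset.sum_eq_zero fun s₂ _ ↦ ?_
  by_cases hm : G.splitEntry H hG hH h t u s₁' s₂ = 0
  · rw [hm, zero_mul]
  by_cases hinc : H.incidence R h t s₂ s₂' = 0
  · rw [hinc, mul_zero]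
  exfalso
  obtain ⟨j, hj, hs₂'⟩ := exists_of_incidence_ne_zero hinc
  exact h₂ ⟨s₂.state, j, hj, G.state_eq_of_splitEntry_ne_zero H hG hH h t hm, hs₂'⟩

/-- **The split map is a chain map (entrywise co-Leibniz rule).** For all enhanced states `u` of
`G # H`, `s₁'` of `G` and `s₂'` of `H`, if every flip of `G` and of `H` is a merge or a split:
`Σ_{u'} ⟨d u, u'⟩ Δ(u'; s₁', s₂') = Σ_{s₁} Δ(u; s₁, s₂') ⟨d s₁, s₁'⟩ + (-1)^{|σ₁'|} Σ_{s₂} Δ(u; s₁', s₂) ⟨d s₂, s₂'⟩`,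
i.e. `Δ ∘ d = (d ⊗ 1 + (-1)^{deg} 1 ⊗ d) ∘ Δ`: the saddle cobordism `D₁ # D₂ → D₁ ⊔ D₂` induces a
chain map. Khovanov (2000), §7.4; Rasmussen (2010), §4.1. [cite: Khovanov2000, §7.4] -/
theorem sum_incidence_mul_splitEntry
    (hms₁ : ∀ (σ : G.State) (k : Fin G.n), σ k = false → G.IsMergeAt σ k ∨ G.IsSplitAt σ k)
    (hms₂ : ∀ (σ : H.State) (k : Fin H.n), σ k = false → H.IsMergeAt σ k ∨ H.IsSplitAt σ k)
    (u : (G.connSum H).EnhancedState) (s₁' : G.EnhancedState) (s₂' : H.EnhancedState) :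
    ∑ u', (G.connSum H).incidence R h t u u' * G.splitEntry H hG hH h t u' s₁' s₂' =
      ∑ s₁, G.splitEntry H hG hH h t u s₁ s₂' * G.incidence R h t s₁ s₁' +
        (-1) ^ s₁'.state.weight * ∑ s₂, G.splitEntry H hG hH h t u s₁' s₂ * H.incidence R h t s₂ s₂' := by
  by_cases h₁ : ∃ (σ₁ : G.State) (i : Fin G.n), σ₁ i = false ∧ u.state = Fin.append σ₁ s₂'.state ∧
      s₁'.state = Function.update σ₁ i true
  · obtain ⟨σ₁, i, hi, hu, hs₁'⟩ := h₁
    have h₂ : ¬ ∃ (σ₂ : H.State) (j : Fin H.n), σ₂ j = false ∧ u.state = Fin.append s₁'.state σ₂ ∧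
        s₂'.state = Function.update σ₂ j true := by
      rintro ⟨σ₂, j, -, hu₂, -⟩
      have e₁ := (G.append_inj H (hu.symm.trans hu₂)).1
      have := congrFun (e₁.trans hs₁') i
      rw [Function.update_self, hi] at this
      exact Bool.noConfusion this
    rw [G.sum_incidence_mul_splitEntry_castAdd H hG hH h t hms₁ hms₂ u s₁' s₂' hi hu hs₁',
      G.sum_splitEntry_mul_incidence_right_eq_zero H hG hH h t u s₁' s₂' h₂, mul_zero, add_zero]
  by_cases h₂ : ∃ (σ₂ : H.State) (j : Fin H.n), σ₂ j = false ∧ u.state = Fin.append s₁'.state σ₂ ∧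
      s₂'.state = Function.update σ₂ j true
  · obtain ⟨σ₂, j, hj, hu, hs₂'⟩ := h₂
    rw [G.sum_incidence_mul_splitEntry_natAdd H hG hH h t hms₁ hms₂ u s₁' s₂' hj hu hs₂',
      G.sum_splitEntry_mul_incidence_left_eq_zero H hG hH h t u s₁' s₂' h₁, zero_add]
  rw [G.sum_incidence_mul_splitEntry_eq_zero H hG hH h t u s₁' s₂' h₁ h₂,
    G.sum_splitEntry_mul_incidence_left_eq_zero H hG hH h t u s₁' s₂' h₁,
    G.sum_splitEntry_mul_incidence_right_eq_zero H hG hH h t u s₁' s₂' h₂, mul_zero, add_zero]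

end ChainMap

/-! ## The split map on cochains: linear form and the co-Leibniz rule -/

section Linear

variable {R : Type} [CommRing R] (h t : R)

/-- **The split map is homogeneous of homological degree `0`**: a nonzero entry `Δ(u; s₁, s₂)`
has `deg u = deg s₁ + deg s₂` (weights and `n₋` add up). Rasmussen (2010), §4.2. [cite: Rasmussen2010, §4.2] -/
theorem homDegree_eq_of_splitEntry_ne_zero {u : (G.connSum H).EnhancedState} {s₁ : G.EnhancedState}
    {s₂ : H.EnhancedState} (hu : G.splitEntry H hG hH h t u s₁ s₂ ≠ 0) :
    homDegree u = homDegree s₁ + homDegree s₂ := by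
  have hst := G.state_eq_of_splitEntry_ne_zero H hG hH h t hu
  simp only [homDegree, hst, weight_append, nMinus_connSum]
  push_cast
  ring

/-- **The split map** `Δ : Cᵏ(G # H) → Cⁱ(G) ⊗ Cʲ(H)` on cochains, the target written as the
coefficient functions on pairs of basis vectors `s₁ ⊗ s₂` (enhanced states of degrees `i`, `j`);
meaningful for `k = i + j` (for other `k` it is zero, all entries vanishing by
`homDegree_eq_of_splitEntry_ne_zero`). The map of the saddle cobordism `D₁ # D₂ → D₁ ⊔ D₂`;
Khovanov (2000), §7.4; Rasmussen (2010), §4.1. [cite: Khovanov2000, §7.4] -/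
def splitMap (k i j : ℤ) :
    ((G.connSum H).degStates k → R) →ₗ[R] (G.degStates i → H.degStates j → R) where
  toFun z s₁ s₂ := ∑ u, z u * G.splitEntry H hG hH h t u.1 s₁.1 s₂.1
  map_add' z z' := by
    funext s₁ s₂
    simp only [Pi.add_apply, add_mul, Finset.sum_add_distrib]
  map_smul' c z := by
    funext s₁ s₂
    simp only [Pi.smul_apply, smul_eq_mul, RingHom.id_apply, Finset.mul_sum, mul_assoc]

/-- The split map, evaluated. [folklore] -/
theorem splitMap_apply (k i j : ℤ) (z : (G.connSum H).degStates k → R) (s₁ : G.degStates i)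
    (s₂ : H.degStates j) :
    G.splitMap H hG hH h t k i j z s₁ s₂ = ∑ u, z u * G.splitEntry H hG hH h t u.1 s₁.1 s₂.1 :=
  rfl

/-- **The co-Leibniz rule for the split map on cochains**:
`Δ (d z) = (d ⊗ 1) (Δ z) + (-1)^{i' + n₋(G)} (1 ⊗ d) (Δ z)` read at a pair `(s₁', s₂')` of degrees
`(i', j')` (with `i' = i + 1`, `j' = j + 1`, `k' = i' + j'`; the source degree `k` is arbitrary, both
sides vanishing for `k ≠ k' - 1`), if every flip of `G` and of `H` is a merge or a split: `d ⊗ 1`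
acts on the first variable of the coefficient function, `1 ⊗ d` on the second, and
`(-1)^{i' + n₋} = (-1)^{|σ₁'|}` is the Koszul sign of the tensor product of the two cube complexes.
Khovanov (2000), §7.4; Rasmussen (2010), §4.1. [cite: Khovanov2000, §7.4] -/
theorem khovanovD_splitMap
    (hms₁ : ∀ (σ : G.State) (k : Fin G.n), σ k = false → G.IsMergeAt σ k ∨ G.IsSplitAt σ k)
    (hms₂ : ∀ (σ : H.State) (k : Fin H.n), σ k = false → H.IsMergeAt σ k ∨ H.IsSplitAt σ k)
    {i j i' j' k' : ℤ} (hk' : k' = i' + j') (hi' : i' = i + 1) (hj' : j' = j + 1) (k : ℤ)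
    (z : (G.connSum H).degStates k → R) :
    G.splitMap H hG hH h t k' i' j' ((G.connSum H).khovanovD R h t k k' z) =
      fun s₁' s₂' ↦ G.khovanovD R h t i i' (fun s₁ ↦ G.splitMap H hG hH h t k i j' z s₁ s₂') s₁' +
        (-1 : R) ^ Int.toNat (i' + G.nMinus) *
          H.khovanovD R h t j j' (G.splitMap H hG hH h t k i' j z s₁') s₂' := by
  funext s₁' s₂'
  simp only [khovanovD_apply, splitMap_apply]
  -- left-hand side: `Σ_{u'} (Σ_u ⟨d u, u'⟩ z u) Δ(u') = Σ_u z u Σ_{u'} ⟨d u, u'⟩ Δ(u')` (all `u'`)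
  have hL : ∑ u' : (G.connSum H).degStates k', (∑ u : (G.connSum H).degStates k,
      (G.connSum H).incidence R h t u.1 u'.1 * z u) * G.splitEntry H hG hH h t u'.1 s₁'.1 s₂'.1 =
      ∑ u : (G.connSum H).degStates k, z u * ∑ u' : (G.connSum H).EnhancedState,
        (G.connSum H).incidence R h t u.1 u' * G.splitEntry H hG hH h t u' s₁'.1 s₂'.1 := by
    calc _ = ∑ u' : (G.connSum H).degStates k', ∑ u : (G.connSum H).degStates k,
          z u * ((G.connSum H).incidence R h t u.1 u'.1 * G.splitEntry H hG hH h t u'.1 s₁'.1 s₂'.1) := by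
          refine Finset.sum_congr rfl fun u' _ ↦ ?_
          rw [Finset.sum_mul]
          exact Finset.sum_congr rfl fun u _ ↦ by ring
      _ = ∑ u : (G.connSum H).degStates k, ∑ u' : (G.connSum H).degStates k',
          z u * ((G.connSum H).incidence R h t u.1 u'.1 * G.splitEntry H hG hH h t u'.1 s₁'.1 s₂'.1) :=
          Finset.sum_comm
      _ = _ := by
          refine Finset.sum_congr rfl fun u _ ↦ ?_
          rw [← Finset.mul_sum, sum_degStates_eq_sum k' (fun u' ↦ (G.connSum H).incidence R h t u.1 u' *
            G.splitEntry H hG hH h t u' s₁'.1 s₂'.1)]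
          intro u' hu'
          by_cases hm : G.splitEntry H hG hH h t u' s₁'.1 s₂'.1 = 0
          · rw [hm, mul_zero]
          · exfalso
            refine hu' ?_
            rw [G.homDegree_eq_of_splitEntry_ne_zero H hG hH h t hm, s₁'.2, s₂'.2, hk']
  -- first right-hand term
  have hR1 : ∑ s₁ : G.degStates i, G.incidence R h t s₁.1 s₁'.1 *
      ∑ u : (G.connSum H).degStates k, z u * G.splitEntry H hG hH h t u.1 s₁.1 s₂'.1 =
      ∑ u : (G.connSum H).degStates k, z u * ∑ s₁ : G.EnhancedState,
        G.splitEntry H hG hH h t u.1 s₁ s₂'.1 * G.incidence R h t s₁ s₁'.1 := by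
    calc _ = ∑ s₁ : G.degStates i, ∑ u : (G.connSum H).degStates k,
          z u * (G.splitEntry H hG hH h t u.1 s₁.1 s₂'.1 * G.incidence R h t s₁.1 s₁'.1) := by
          refine Finset.sum_congr rfl fun s₁ _ ↦ ?_
          rw [Finset.mul_sum]
          exact Finset.sum_congr rfl fun u _ ↦ by ring
      _ = ∑ u : (G.connSum H).degStates k, ∑ s₁ : G.degStates i,
          z u * (G.splitEntry H hG hH h t u.1 s₁.1 s₂'.1 * G.incidence R h t s₁.1 s₁'.1) :=
          Finset.sum_comm
      _ = _ := by
          refine Finset.sum_congr rfl fun u _ ↦ ?_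
          rw [← Finset.mul_sum, sum_degStates_eq_sum i (fun s₁ ↦ G.splitEntry H hG hH h t u.1 s₁ s₂'.1 *
            G.incidence R h t s₁ s₁'.1)]
          intro s₁ hs
          by_cases hinc : G.incidence R h t s₁ s₁'.1 = 0
          · rw [hinc, mul_zero]
          · exfalso
            refine hs ?_
            have := homDegree_eq_of_incidence_ne_zero hinc
            rw [s₁'.2, hi'] at this
            linarith
  -- second right-hand term
  have hR2 : ∑ s₂ : H.degStates j, H.incidence R h t s₂.1 s₂'.1 *
      ∑ u : (G.connSum H).degStates k, z u * G.splitEntry H hG hH h t u.1 s₁'.1 s₂.1 =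
      ∑ u : (G.connSum H).degStates k, z u * ∑ s₂ : H.EnhancedState,
        G.splitEntry H hG hH h t u.1 s₁'.1 s₂ * H.incidence R h t s₂ s₂'.1 := by
    calc _ = ∑ s₂ : H.degStates j, ∑ u : (G.connSum H).degStates k,
          z u * (G.splitEntry H hG hH h t u.1 s₁'.1 s₂.1 * H.incidence R h t s₂.1 s₂'.1) := by
          refine Finset.sum_congr rfl fun s₂ _ ↦ ?_
          rw [Finset.mul_sum]
          exact Finset.sum_congr rfl fun u _ ↦ by ring
      _ = ∑ u : (G.connSum H).degStates k, ∑ s₂ : H.degStates j,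
          z u * (G.splitEntry H hG hH h t u.1 s₁'.1 s₂.1 * H.incidence R h t s₂.1 s₂'.1) :=
          Finset.sum_comm
      _ = _ := by
          refine Finset.sum_congr rfl fun u _ ↦ ?_
          rw [← Finset.mul_sum, sum_degStates_eq_sum j (fun s₂ ↦ G.splitEntry H hG hH h t u.1 s₁'.1 s₂ *
            H.incidence R h t s₂ s₂'.1)]
          intro s₂ hs
          by_cases hinc : H.incidence R h t s₂ s₂'.1 = 0
          · rw [hinc, mul_zero]
          · exfalso
            refine hs ?_
            have := homDegree_eq_of_incidence_ne_zero hinc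
            rw [s₂'.2, hj'] at this
            linarith
  rw [hL, hR1, hR2, Finset.mul_sum, ← Finset.sum_add_distrib]
  refine Finset.sum_congr rfl fun u _ ↦ ?_
  rw [G.sum_incidence_mul_splitEntry H hG hH h t hms₁ hms₂, ← G.neg_one_pow_weight_eq (R := R) s₁']
  ring

/-- **`Δ` maps cycles to cycles of the tensor product**: for a cycle `z ∈ Cᵏ(G # H)`,
`(d ⊗ 1) (Δ z) + (-1)^{i' + n₋(G)} (1 ⊗ d) (Δ z) = 0` at every pair of degrees `(i', j')` with
`i' + j' = k + 1`. [cite: Khovanov2000, §7.4] -/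
theorem khovanovD_splitMap_of_mem_ker
    (hms₁ : ∀ (σ : G.State) (k : Fin G.n), σ k = false → G.IsMergeAt σ k ∨ G.IsSplitAt σ k)
    (hms₂ : ∀ (σ : H.State) (k : Fin H.n), σ k = false → H.IsMergeAt σ k ∨ H.IsSplitAt σ k)
    {k i j i' j' : ℤ} (hk : k + 1 = i' + j') (hi' : i' = i + 1) (hj' : j' = j + 1)
    {z : (G.connSum H).degStates k → R} (hz : z ∈ LinearMap.ker ((G.connSum H).khovanovD R h t k (k + 1)))
    (s₁' : G.degStates i') (s₂' : H.degStates j') :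
    G.khovanovD R h t i i' (fun s₁ ↦ G.splitMap H hG hH h t k i j' z s₁ s₂') s₁' +
        (-1 : R) ^ Int.toNat (i' + G.nMinus) *
          H.khovanovD R h t j j' (G.splitMap H hG hH h t k i' j z s₁') s₂' = 0 := by
  rw [LinearMap.mem_ker] at hz
  have := congrFun (congrFun (G.khovanovD_splitMap H hG hH h t hms₁ hms₂ hk hi' hj' k z) s₁') s₂'
  rw [hz, map_zero] at this
  exact this.symm

end Linear

/-! ## Degrees: the split map is filtered of quantum degree `-1` (Lee's system, `h = 0`) -/

section Degrees

/-- The structure constants of the comultiplication of `A = R[X]/(X² - t)` (`h = 0`) lower the total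
label degree by at most one: `deg v + deg w - deg z ∈ {-1, 3}` whenever `splitCoeff 0 t z v w ≠ 0`
(`Δ 1 = 1 ⊗ X + X ⊗ 1`, `Δ X = X ⊗ X + t 1 ⊗ 1`): Lee's `Δ' = Δ + Φ_Δ` with `Φ_Δ` of degree `4`
(Rasmussen (2010), proof of Lemma 3.5). [cite: Rasmussen2010, Lemma 3.5] -/
theorem labelDeg_add_sub_ge_of_splitCoeff_ne_zero {R : Type} [CommRing R] {t : R} {z v w : Bool}
    (hc : splitCoeff R 0 t z v w ≠ 0) : -1 ≤ labelDeg v + labelDeg w - labelDeg z := by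
  cases z <;> cases v <;> cases w <;> simp [splitCoeff, labelDeg] at hc ⊢

/-- **The split map is filtered of quantum degree `-1`** (Lee's system `h = 0`): a nonzero entry
`Δ(u; s₁, s₂)` has `qDegree s₁ + qDegree s₂ ≥ qDegree u - 1`. This is `χ(S) = -1` for the saddle
cobordism `S : D₁ # D₂ → D₁ ⊔ D₂`; Rasmussen (2010), §4.2 (the map of an elementary cobordism of
Euler characteristic `χ` is filtered of degree `χ`). [cite: Rasmussen2010, §4.2] -/
theorem qDegree_le_of_splitEntry_ne_zero {R : Type} [CommRing R] (t : R) {u : (G.connSum H).EnhancedState}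
    {s₁ : G.EnhancedState} {s₂ : H.EnhancedState} (hm : G.splitEntry H hG hH 0 t u s₁ s₂ ≠ 0) :
    qDegree u - 1 ≤ qDegree s₁ + qDegree s₂ := by
  obtain ⟨σ₁, la₁, hla₁⟩ := s₁
  obtain ⟨σ₂, la₂, hla₂⟩ := s₂
  have hst := G.state_eq_of_splitEntry_ne_zero H hG hH 0 t hm
  obtain ⟨τ, lab, hlab⟩ := u
  simp only at hst
  subst hst
  rw [splitEntry, if_pos rfl] at hm
  unfold KhFace.splitInc at hm
  split_ifs at hm with hagree
  · have hlabL : ∀ x y, (G.connSum H).circleOf (Fin.append σ₁ σ₂) x =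
        (G.connSum H).circleOf (Fin.append σ₁ σ₂) y → lab x = lab y := fun x y hxy ↦
      (⟨_, lab, hlab⟩ : (G.connSum H).EnhancedState).label_eq_of_circleOf_eq hxy
    have hq := G.qDegree_ofLab_connSum H hG hH σ₁ la₁ hla₁ σ₂ la₂ hla₂ ⟨lab, hlabL⟩
      (fun x hx ↦ (hagree x hx).symm)
    change qDegree (⟨Fin.append σ₁ σ₂, lab, hlab⟩ : (G.connSum H).EnhancedState) = _ at hq
    have hd := labelDeg_add_sub_ge_of_splitCoeff_ne_zero hm
    simp only [Sum.elim_inl, Sum.elim_inr, Function.comp_apply, arcEquiv_inl] at hd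
    change -1 ≤ labelDeg (la₁ G.baseArc) + labelDeg (la₂ H.baseArc) -
      labelDeg (lab (G.inlArc H G.baseArc)) at hd
    rw [hq]
    linarith
  · exact (hm rfl).elim

/-- **Filtration, pointwise.** If `m ≤ q(z)` for the filtration degree of a degree-zero chain `z` of
`G # H` (Lee's theory over `ℚ`), every pair `(s₁, s₂)` in the support of `Δ z` has
`qDegree s₁ + qDegree s₂ ≥ m - 1`: `Δ` is filtered of degree `-1` for the tensor product
filtration. Rasmussen (2010), §4.2. [cite: Rasmussen2010, §4.2] -/
theorem qDegree_add_ge_of_splitMap_ne_zero (t : ℚ) (z : (G.connSum H).degStates 0 → ℚ) {m : ℤ}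
    (hm : ((m : WithTop ℤ) : WithBot (WithTop ℤ)) ≤ qMin z) (s₁ : G.degStates 0) (s₂ : H.degStates 0)
    (hs : G.splitMap H hG hH 0 t 0 0 0 z s₁ s₂ ≠ 0) : m - 1 ≤ qDegree s₁.1 + qDegree s₂.1 := by
  rw [coe_le_qMin_iff] at hm
  rw [splitMap_apply] at hs
  obtain ⟨u, -, hu⟩ := Finset.exists_ne_zero_of_sum_ne_zero hs
  have hz : z u ≠ 0 := fun h0 ↦ hu (by rw [h0, zero_mul])
  have he : G.splitEntry H hG hH 0 t u.1 s₁.1 s₂.1 ≠ 0 := fun h0 ↦ hu (by rw [h0, mul_zero])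
  have := G.qDegree_le_of_splitEntry_ne_zero H hG hH t he
  have := hm u hz
  linarith

/-- **Filtration, slicewise.** If `m ≤ q(z)`, then for every degree-zero enhanced state `s₁` of `G`
the slice `Δ z (s₁, ·)`, a degree-zero chain of `H`, has filtration degree `≥ m - 1 - qDegree s₁`.
[cite: Rasmussen2010, §4.2] -/
theorem le_qMin_splitMap_apply (t : ℚ) (z : (G.connSum H).degStates 0 → ℚ) {m : ℤ}
    (hm : ((m : WithTop ℤ) : WithBot (WithTop ℤ)) ≤ qMin z) (s₁ : G.degStates 0) :
    (((m - 1 - qDegree s₁.1 : ℤ) : WithTop ℤ) : WithBot (WithTop ℤ)) ≤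
      qMin (G.splitMap H hG hH 0 t 0 0 0 z s₁) := by
  rw [coe_le_qMin_iff]
  intro s₂ hs
  have := G.qDegree_add_ge_of_splitMap_ne_zero H hG hH t z hm s₁ s₂ hs
  linarith

end Degrees

/-! ## Lee theory: the split map in Lee's coordinates -/

section LeeCoord

/-- **Signs of a relabelling on one circle.** For labellings `f`, `ℓ` of `τ`, putting `v` on the
circle of `A`: `(-1)^{pairCount τ f[A ↦ v] ℓ} = (-1)^{pairCount τ f ℓ} · s(f A, ℓ A) s(v, ℓ A)` (only the
circle of `A` changes its contribution; cf. `neg_one_pow_pairCount_flipLab`). [folklore] -/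
theorem neg_one_pow_pairCount_upd {K : GaussDiagram} {τ : K.State} (A : K.Arc) {f ell : K.Arc → Bool}
    (hf : K.IsLabelOf τ f) (he : K.IsLabelOf τ ell) (v : Bool) :
    (-1 : ℚ) ^ K.pairCount τ (KhFace.upd (K.circleOf τ) f A v) ell =
      (-1 : ℚ) ^ K.pairCount τ f ell * pairSign (f A) (ell A) * pairSign v (ell A) := by
  by_cases hv : v = f A
  · subst hv
    have hupd : KhFace.upd (K.circleOf τ) f A (f A) = f := by
      funext x
      unfold KhFace.upd
      split_ifs with hx
      · exact (lab_of_isLabelOf hf x A hx).symm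
      · rfl
    rw [hupd, mul_assoc, pairSign_mul_self, mul_one]
  · have hv' : v = !f A := by
      cases v <;> cases hfa : f A <;> simp_all
    subst hv'
    have hflip := neg_one_pow_pairCount_flipLab τ A ⟨f, lab_of_isLabelOf hf⟩ he
    simp only [flipLab] at hflip
    rw [hflip, pairSign_not]
    have hs := pairSign_mul_self (f A) (ell A)
    linear_combination (-((-1 : ℚ) ^ K.pairCount τ f ell * leeSign (ell A))) * hs

/-- **Lee coordinates of a function on pairs** of degree-zero enhanced states of `G` and `H`
(an element of `C⁰(G) ⊗ C⁰(H)`): Lee's coordinates `leeCoord 0` taken in each variable, i.e. the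
pairings with the pairs of Lee monomials `u₁ ⊗ u₂` — the tensor square of Lee's inner product.
Lee (2005), §4.4. [cite: Lee2005, §4.4] -/
def leeCoord₂ : (G.degStates 0 → H.degStates 0 → ℚ) →ₗ[ℚ] (G.degStates 0 → H.degStates 0 → ℚ) where
  toFun F u₁ u₂ := G.leeCoord 0 (fun s₁ ↦ H.leeCoord 0 (F s₁) u₂) u₁
  map_add' F F' := by
    funext u₁ u₂
    simp only [Pi.add_apply, map_add]
    have hF : (fun s₁ ↦ H.leeCoord 0 (F s₁) u₂ + H.leeCoord 0 (F' s₁) u₂) =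
        (fun s₁ ↦ H.leeCoord 0 (F s₁) u₂) + fun s₁ ↦ H.leeCoord 0 (F' s₁) u₂ := rfl
    rw [hF, map_add, Pi.add_apply]
  map_smul' c F := by
    funext u₁ u₂
    simp only [Pi.smul_apply, map_smul, RingHom.id_apply]
    have hF : (fun s₁ ↦ c • H.leeCoord 0 (F s₁) u₂) = c • fun s₁ ↦ H.leeCoord 0 (F s₁) u₂ := rfl
    rw [hF, map_smul, Pi.smul_apply]

/-- Lee coordinates on pairs, evaluated. [folklore] -/
theorem leeCoord₂_apply (F : G.degStates 0 → H.degStates 0 → ℚ) (u₁ : G.degStates 0) (u₂ : H.degStates 0) :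
    G.leeCoord₂ H F u₁ u₂ = G.leeCoord 0 (fun s₁ ↦ H.leeCoord 0 (F s₁) u₂) u₁ :=
  rfl

/-- **Lee coordinates on pairs are faithful** (both `leeCoord 0` are isomorphisms). [cite: Lee2005, §4.4] -/
theorem leeCoord₂_injective : Function.Injective (G.leeCoord₂ H) := by
  intro F F' hFF'
  funext s₁ s₂
  have h1 : ∀ u₂, (fun s₁ ↦ H.leeCoord 0 (F s₁) u₂) = fun s₁ ↦ H.leeCoord 0 (F' s₁) u₂ := fun u₂ ↦
    (G.leeCoord 0).injective (funext fun u₁ ↦ congrFun (congrFun hFF' u₁) u₂)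
  have h2 : H.leeCoord 0 (F s₁) = H.leeCoord 0 (F' s₁) := funext fun u₂ ↦ congrFun (h1 u₂) s₁
  exact congrFun ((H.leeCoord 0).injective h2) s₂

/-- **Lee coordinates of an elementary tensor** `x ⊗ y` are the products of the coordinates.
[cite: Lee2005, §4.4] -/
theorem leeCoord₂_tmul (x : G.degStates 0 → ℚ) (y : H.degStates 0 → ℚ) (u₁ : G.degStates 0)
    (u₂ : H.degStates 0) :
    G.leeCoord₂ H (fun s₁ s₂ ↦ x s₁ * y s₂) u₁ u₂ = G.leeCoord 0 x u₁ * H.leeCoord 0 y u₂ := by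
  rw [leeCoord₂_apply]
  have hx : (fun s₁ ↦ H.leeCoord 0 (fun s₂ ↦ x s₁ * y s₂) u₂) = H.leeCoord 0 y u₂ • x := by
    funext s₁
    have hy : (fun s₂ ↦ x s₁ * y s₂) = x s₁ • y := by
      funext s₂; simp only [Pi.smul_apply, smul_eq_mul]
    rw [hy, map_smul, Pi.smul_apply, smul_eq_mul, Pi.smul_apply, smul_eq_mul, mul_comm]
  rw [hx, map_smul, Pi.smul_apply, smul_eq_mul, mul_comm]

variable {σ₁ : G.State} {σ₂ : H.State}

include hG hH in
/-- A labelling of `(σ₁, σ₂)` in `G # H` restricts to a labelling of `σ₁`. [folklore] -/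
theorem isLabelOf_comp_inlArc (lab : KhFace.Lab ((G.connSum H).circleOf (Fin.append σ₁ σ₂))) :
    G.IsLabelOf σ₁ (lab.1 ∘ G.inlArc H) :=
  isLabelOf_of_lab ⟨lab.1 ∘ G.inlArc H, fun a b hab ↦
    lab.2 _ _ ((G.circleOf_inlArc_eq_iff H σ₁ σ₂ hG hH a b).2 hab)⟩

include hG hH in
/-- A labelling of `(σ₁, σ₂)` in `G # H` restricts to a labelling of `σ₂`. [folklore] -/
theorem isLabelOf_comp_inrArc (lab : KhFace.Lab ((G.connSum H).circleOf (Fin.append σ₁ σ₂))) :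
    H.IsLabelOf σ₂ (lab.1 ∘ G.inrArc H) :=
  isLabelOf_of_lab ⟨lab.1 ∘ G.inrArc H, fun a b hab ↦
    lab.2 _ _ ((G.circleOf_inrArc_eq_iff H σ₁ σ₂ hG hH a b).2 hab)⟩

/-- **A labelling of `(σ₁, σ₂)` in `G # H` is the merged labelling of its restrictions** (with its
own value on the glued base circle). [folklore] -/
theorem mergedLab_comp_inlArc_comp_inrArc (lab : KhFace.Lab ((G.connSum H).circleOf (Fin.append σ₁ σ₂))) :
    G.mergedLab H hG hH (σ₁ := σ₁) (σ₂ := σ₂) (lab.1 ∘ G.inlArc H) (lab.1 ∘ G.inrArc H)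
      (lab.1 (G.inlArc H G.baseArc)) = lab.1 := by
  funext r
  obtain ⟨x, rfl⟩ := (G.arcEquiv H hG hH).surjective r
  rcases x with a | b
  · rw [arcEquiv_inl, mergedLab_inlArc]
    split_ifs with ha
    · exact lab.2 _ _ ((G.circleOf_inlArc_eq_iff H σ₁ σ₂ hG hH _ _).2 ha.symm)
    · rfl
  · rw [arcEquiv_inr, mergedLab_inrArc]
    split_ifs with hb
    · exact lab.2 _ _ ((G.circleOf_inlArc_eq_inrArc_iff H σ₁ σ₂ hG hH _ _).2 ⟨rfl, hb⟩)
    · rfl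

/-- Splitting a labelling read on blocks along the two base circles: the first block sees the
update at the base circle of `G`. [folklore] -/
theorem upd_upd_sumMap_comp_inl (f : G.Arc ⊕ H.Arc → Bool) (v w : Bool) :
    KhFace.upd (Sum.map (G.circleOf σ₁) (H.circleOf σ₂))
        (KhFace.upd (Sum.map (G.circleOf σ₁) (H.circleOf σ₂)) f (Sum.inr H.baseArc) w)
        (Sum.inl G.baseArc) v ∘ Sum.inl =
      KhFace.upd (G.circleOf σ₁) (f ∘ Sum.inl) G.baseArc v := by
  funext a
  simp [KhFace.upd]

/-- Splitting a labelling read on blocks along the two base circles: the second block sees the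
update at the base circle of `H`. [folklore] -/
theorem upd_upd_sumMap_comp_inr (f : G.Arc ⊕ H.Arc → Bool) (v w : Bool) :
    KhFace.upd (Sum.map (G.circleOf σ₁) (H.circleOf σ₂))
        (KhFace.upd (Sum.map (G.circleOf σ₁) (H.circleOf σ₂)) f (Sum.inr H.baseArc) w)
        (Sum.inl G.baseArc) v ∘ Sum.inr =
      KhFace.upd (H.circleOf σ₂) (f ∘ Sum.inr) H.baseArc w := by
  funext b
  simp [KhFace.upd]

/-- **The split in Lee's coordinates, one fibre.** For a labelling `lab` of `(σ₁, σ₂)` in `G # H` and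
Lee monomials `ℓ₁` of `σ₁`, `ℓ₂` of `σ₂`, the signed sum of the split incidence numbers over all
pairs of labellings of the blocks collapses (`KhFace.sum_splitInc_mul`, `neg_one_pow_pairCount_upd`)
to the signs of the restrictions of `lab` times the one-circle table
`Σ_{v w} Δ(x; v, w) s(v, ℓ₁ B₁) s(w, ℓ₂ B₂)` of `split_table`. [cite: Lee2005, §4] -/
theorem sum_sum_neg_one_pow_mul_splitInc (lab : KhFace.Lab ((G.connSum H).circleOf (Fin.append σ₁ σ₂)))
    {ell₁ : G.Arc → Bool} {ell₂ : H.Arc → Bool} (he₁ : G.IsLabelOf σ₁ ell₁) (he₂ : H.IsLabelOf σ₂ ell₂) :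
    ∑ mu₁ : KhFace.Lab (G.circleOf σ₁), ∑ mu₂ : KhFace.Lab (H.circleOf σ₂),
      (-1 : ℚ) ^ G.pairCount σ₁ mu₁.1 ell₁ * (-1 : ℚ) ^ H.pairCount σ₂ mu₂.1 ell₂ *
        KhFace.splitInc ℚ 0 1 ((G.connSum H).circleOf (Fin.append σ₁ σ₂) ∘ G.arcEquiv H hG hH)
          (lab.1 ∘ G.arcEquiv H hG hH) (Sum.elim mu₁.1 mu₂.1) (Sum.inl G.baseArc) (Sum.inr H.baseArc) =
      (-1 : ℚ) ^ G.pairCount σ₁ (lab.1 ∘ G.inlArc H) ell₁ * (-1 : ℚ) ^ H.pairCount σ₂ (lab.1 ∘ G.inrArc H) ell₂ *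
        pairSign (lab.1 (G.inlArc H G.baseArc)) (ell₁ G.baseArc) *
        pairSign (lab.1 (G.inrArc H H.baseArc)) (ell₂ H.baseArc) *
        ∑ v : Bool, ∑ w : Bool, splitCoeff ℚ 0 1 (lab.1 (G.inlArc H G.baseArc)) v w *
          pairSign v (ell₁ G.baseArc) * pairSign w (ell₂ H.baseArc) := by
  classical
  have hlab' : ∀ x y, ((G.connSum H).circleOf (Fin.append σ₁ σ₂) ∘ G.arcEquiv H hG hH) x =
      ((G.connSum H).circleOf (Fin.append σ₁ σ₂) ∘ G.arcEquiv H hG hH) y →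
      (lab.1 ∘ G.arcEquiv H hG hH) x = (lab.1 ∘ G.arcEquiv H hG hH) y := fun x y hxy ↦ lab.2 _ _ hxy
  set F : (G.Arc ⊕ H.Arc → Bool) → ℚ := fun m ↦
    (-1 : ℚ) ^ G.pairCount σ₁ (m ∘ Sum.inl) ell₁ * (-1 : ℚ) ^ H.pairCount σ₂ (m ∘ Sum.inr) ell₂ with hF
  have key := KhFace.sum_splitInc_mul (R := ℚ) (h := 0) (t := 1) (G.connSum_surg H σ₁ σ₂ hG hH)
    ⟨lab.1 ∘ G.arcEquiv H hG hH, hlab'⟩ F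
  rw [Fintype.sum_equiv (KhFace.labSumEquiv (G.circleOf σ₁) (H.circleOf σ₂)) _
    (fun p ↦ KhFace.splitInc ℚ 0 1 ((G.connSum H).circleOf (Fin.append σ₁ σ₂) ∘ G.arcEquiv H hG hH)
        (lab.1 ∘ G.arcEquiv H hG hH) (Sum.elim p.1.1 p.2.1) (Sum.inl G.baseArc) (Sum.inr H.baseArc) *
      F (Sum.elim p.1.1 p.2.1))
    (fun mu ↦ by simp only [KhFace.labSumEquiv, Equiv.coe_fn_mk, Sum.elim_comp_inl_inr]),
    Fintype.sum_prod_type] at key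
  calc _ = ∑ mu₁ : KhFace.Lab (G.circleOf σ₁), ∑ mu₂ : KhFace.Lab (H.circleOf σ₂),
        KhFace.splitInc ℚ 0 1 ((G.connSum H).circleOf (Fin.append σ₁ σ₂) ∘ G.arcEquiv H hG hH)
          (lab.1 ∘ G.arcEquiv H hG hH) (Sum.elim mu₁.1 mu₂.1) (Sum.inl G.baseArc) (Sum.inr H.baseArc) *
        F (Sum.elim mu₁.1 mu₂.1) := by
        refine Finset.sum_congr rfl fun mu₁ _ ↦ Finset.sum_congr rfl fun mu₂ _ ↦ ?_
        simp only [hF, Sum.elim_comp_inl, Sum.elim_comp_inr]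
        ring
    _ = _ := key
    _ = _ := by
        simp only [hF, upd_upd_sumMap_comp_inl, upd_upd_sumMap_comp_inr, Function.comp_apply,
          arcEquiv_inl]
        have h1 : (lab.1 ∘ G.arcEquiv H hG hH) ∘ Sum.inl = lab.1 ∘ G.inlArc H := by
          funext a; simp
        have h2 : (lab.1 ∘ G.arcEquiv H hG hH) ∘ Sum.inr = lab.1 ∘ G.inrArc H := by
          funext b; simp
        simp only [h1, h2, neg_one_pow_pairCount_upd G.baseArc (G.isLabelOf_comp_inlArc H hG hH lab) he₁,
          neg_one_pow_pairCount_upd H.baseArc (G.isLabelOf_comp_inrArc H hG hH lab) he₂,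
          Function.comp_apply, Finset.mul_sum]
        refine Finset.sum_congr rfl fun v _ ↦ Finset.sum_congr rfl fun w _ ↦ ?_
        ring

/-- **The split map in Lee's coordinates.** For a degree-zero cochain `z` of `G # H` and Lee
monomials `u₁ = (σ₁, ℓ₁)`, `u₂ = (σ₂, ℓ₂)` of the blocks, the pairing of `Δ z` with `u₁ ⊗ u₂` is
`2 ⟨z, glue u₁ u₂⟩` if `ℓ₁`, `ℓ₂` agree on the base arcs and `0` otherwise: in Lee's basis
`𝐚 = 𝟙 + X`, `𝐛 = -𝟙 + X` the comultiplication of `A = ℚ[X]/(X² - 1)` is diagonal, `Δ 𝐚 = 𝐚 ⊗ 𝐚`,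
`Δ 𝐛 = 𝐛 ⊗ 𝐛` (Lee (2005), §4; Rasmussen (2010), §2.4), read through the orthogonality relations
`Mᵀ M = 2` of the dual coordinates (`split_table`, `split_table_zero`). [cite: Rasmussen2010, Prop. 4.1] -/
theorem leeCoord₂_splitMap (z : (G.connSum H).degStates 0 → ℚ) (u₁ : G.degStates 0) (u₂ : H.degStates 0) :
    G.leeCoord₂ H (G.splitMap H hG hH 0 1 0 0 0 z) u₁ u₂ =
      if hb : u₁.1.label G.baseArc = u₂.1.label H.baseArc then
        2 * (G.connSum H).leeCoord 0 z (glue₀ hG hH u₁ u₂ hb) else 0 := by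
  classical
  obtain ⟨⟨σ₁, ℓ₁, hℓ₁⟩, h0₁⟩ := u₁
  obtain ⟨⟨σ₂, ℓ₂, hℓ₂⟩, h0₂⟩ := u₂
  dsimp only
  have hk₁ : (σ₁.weight : ℤ) - G.nMinus = 0 := by rwa [homDegree] at h0₁
  have hk₂ : (σ₂.weight : ℤ) - H.nMinus = 0 := by rwa [homDegree] at h0₂
  have he₁ : G.IsLabelOf σ₁ ℓ₁ := hℓ₁
  have he₂ : H.IsLabelOf σ₂ ℓ₂ := hℓ₂
  have hkD : ((State.weight (G := G.connSum H) (Fin.append σ₁ σ₂) : ℕ) : ℤ) - (G.connSum H).nMinus = 0 := by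
    rw [weight_append, nMinus_connSum]; push_cast; linarith
  -- ### Step 1: expand both coordinates and the split map over the fibres of `σ₁`, `σ₂`, `(σ₁, σ₂)`
  have hin : ∀ mu₁ : KhFace.Lab (G.circleOf σ₁),
      H.leeCoord 0 (G.splitMap H hG hH 0 1 0 0 0 z ((G.stateFibreLabEquiv 0 σ₁ hk₁).symm mu₁).1)
        ⟨⟨σ₂, ℓ₂, hℓ₂⟩, h0₂⟩ =
      ∑ mu₂ : KhFace.Lab (H.circleOf σ₂), (-1 : ℚ) ^ H.pairCount σ₂ mu₂.1 ℓ₂ *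
        ∑ lab : KhFace.Lab ((G.connSum H).circleOf (Fin.append σ₁ σ₂)),
          z (((G.connSum H).stateFibreLabEquiv 0 (Fin.append σ₁ σ₂) hkD).symm lab).1 *
          KhFace.splitInc ℚ 0 1 ((G.connSum H).circleOf (Fin.append σ₁ σ₂) ∘ G.arcEquiv H hG hH)
            (lab.1 ∘ G.arcEquiv H hG hH) (Sum.elim mu₁.1 mu₂.1) (Sum.inl G.baseArc) (Sum.inr H.baseArc) := by
    intro mu₁
    rw [leeCoord_apply_eq_sum_lab]
    change ∑ mu₂ : KhFace.Lab (H.circleOf σ₂), (-1 : ℚ) ^ H.pairCount σ₂ mu₂.1 ℓ₂ *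
      G.splitMap H hG hH 0 1 0 0 0 z ((G.stateFibreLabEquiv 0 σ₁ hk₁).symm mu₁).1
        ((H.stateFibreLabEquiv 0 σ₂ hk₂).symm mu₂).1 = _
    refine Finset.sum_congr rfl fun mu₂ _ ↦ ?_
    congr 1
    rw [splitMap_apply, sum_degStates_eq_sum_lab 0 (Fin.append σ₁ σ₂) hkD _ (fun u hu ↦ ?_)]
    · refine Finset.sum_congr rfl fun lab _ ↦ ?_
      congr 1
      exact if_pos rfl
    · rw [G.splitEntry_of_ne H hG hH 0 1 hu, mul_zero]
  have hexp : G.leeCoord₂ H (G.splitMap H hG hH 0 1 0 0 0 z) ⟨⟨σ₁, ℓ₁, hℓ₁⟩, h0₁⟩ ⟨⟨σ₂, ℓ₂, hℓ₂⟩, h0₂⟩ =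
      ∑ lab : KhFace.Lab ((G.connSum H).circleOf (Fin.append σ₁ σ₂)),
        z (((G.connSum H).stateFibreLabEquiv 0 (Fin.append σ₁ σ₂) hkD).symm lab).1 *
        ∑ mu₁ : KhFace.Lab (G.circleOf σ₁), ∑ mu₂ : KhFace.Lab (H.circleOf σ₂),
          (-1 : ℚ) ^ G.pairCount σ₁ mu₁.1 ℓ₁ * (-1 : ℚ) ^ H.pairCount σ₂ mu₂.1 ℓ₂ *
            KhFace.splitInc ℚ 0 1 ((G.connSum H).circleOf (Fin.append σ₁ σ₂) ∘ G.arcEquiv H hG hH)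
              (lab.1 ∘ G.arcEquiv H hG hH) (Sum.elim mu₁.1 mu₂.1) (Sum.inl G.baseArc) (Sum.inr H.baseArc) := by
    rw [leeCoord₂_apply, leeCoord_apply_eq_sum_lab]
    change ∑ mu₁ : KhFace.Lab (G.circleOf σ₁), (-1 : ℚ) ^ G.pairCount σ₁ mu₁.1 ℓ₁ *
        H.leeCoord 0 (G.splitMap H hG hH 0 1 0 0 0 z ((G.stateFibreLabEquiv 0 σ₁ hk₁).symm mu₁).1)
          ⟨⟨σ₂, ℓ₂, hℓ₂⟩, h0₂⟩ = _
    simp only [hin, Finset.mul_sum]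
    conv_rhs => rw [Finset.sum_comm]
    refine Finset.sum_congr rfl fun mu₁ _ ↦ ?_
    conv_rhs => rw [Finset.sum_comm]
    exact Finset.sum_congr rfl fun mu₂ _ ↦ Finset.sum_congr rfl fun lab _ ↦ by ring
  rw [hexp]
  simp only [G.sum_sum_neg_one_pow_mul_splitInc H hG hH _ he₁ he₂]
  -- ### Step 2: the one-circle tables
  by_cases hb : ℓ₁ G.baseArc = ℓ₂ H.baseArc
  · rw [dif_pos hb, leeCoord_apply_eq_sum_lab]
    change _ = 2 * ∑ lab : KhFace.Lab ((G.connSum H).circleOf (Fin.append σ₁ σ₂)),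
      (-1 : ℚ) ^ (G.connSum H).pairCount (Fin.append σ₁ σ₂) lab.1 (G.glueLab H hG hH ℓ₁ ℓ₂) *
        z (((G.connSum H).stateFibreLabEquiv 0 (Fin.append σ₁ σ₂) hkD).symm lab).1
    rw [Finset.mul_sum]
    refine Finset.sum_congr rfl fun lab _ ↦ ?_
    have hx₂ : lab.1 (G.inrArc H H.baseArc) = lab.1 (G.inlArc H G.baseArc) :=
      lab.2 _ _ ((G.circleOf_inlArc_eq_inrArc_iff H σ₁ σ₂ hG hH _ _).2 ⟨rfl, rfl⟩).symm
    have htab := split_table (lab.1 (G.inlArc H G.baseArc)) (ℓ₁ G.baseArc)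
    have hsign := G.neg_one_pow_pairCount_mergedLab H hG hH (G.isLabelOf_comp_inlArc H hG hH lab) he₁
      (G.isLabelOf_comp_inrArc H hG hH lab) he₂ hb (lab.1 (G.inlArc H G.baseArc))
    rw [G.mergedLab_comp_inlArc_comp_inrArc H hG hH lab] at hsign
    simp only [Function.comp_apply] at hsign
    rw [hx₂] at hsign
    rw [hx₂, ← hb, hsign]
    have hs := pairSign_mul_self (lab.1 (G.inlArc H G.baseArc)) (ℓ₁ G.baseArc)
    linear_combination (z (((G.connSum H).stateFibreLabEquiv 0 (Fin.append σ₁ σ₂) hkD).symm lab).1 *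
        (-1 : ℚ) ^ G.pairCount σ₁ (lab.1 ∘ G.inlArc H) ℓ₁ *
        (-1 : ℚ) ^ H.pairCount σ₂ (lab.1 ∘ G.inrArc H) ℓ₂ *
        pairSign (lab.1 (G.inlArc H G.baseArc)) (ℓ₁ G.baseArc)) * htab -
      (2 * z (((G.connSum H).stateFibreLabEquiv 0 (Fin.append σ₁ σ₂) hkD).symm lab).1 *
        (-1 : ℚ) ^ G.pairCount σ₁ (lab.1 ∘ G.inlArc H) ℓ₁ *
        (-1 : ℚ) ^ H.pairCount σ₂ (lab.1 ∘ G.inrArc H) ℓ₂ *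
        pairSign (lab.1 (G.inlArc H G.baseArc)) (ℓ₁ G.baseArc)) * hs
  · rw [dif_neg hb]
    refine Finset.sum_eq_zero fun lab _ ↦ ?_
    rw [split_table_zero _ _ _ hb, mul_zero, mul_zero]

/-- **The Lee coordinates of `Δ z` vanish on pairs of monomials with different labels on the base
arcs** (`Δ 𝐚`, `Δ 𝐛` have no mixed component). [cite: Rasmussen2010, Prop. 4.1] -/
theorem leeCoord₂_splitMap_of_ne (z : (G.connSum H).degStates 0 → ℚ) (u₁ : G.degStates 0)
    (u₂ : H.degStates 0) (hb : u₁.1.label G.baseArc ≠ u₂.1.label H.baseArc) :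
    G.leeCoord₂ H (G.splitMap H hG hH 0 1 0 0 0 z) u₁ u₂ = 0 := by
  rw [leeCoord₂_splitMap, dif_neg hb]

/-- **The Lee coordinates of `Δ z` at a glued pair are twice those of `z` at the glued monomial.**
[cite: Rasmussen2010, Prop. 4.1] -/
theorem leeCoord₂_splitMap_of_eq (z : (G.connSum H).degStates 0 → ℚ) (u₁ : G.degStates 0)
    (u₂ : H.degStates 0) (hb : u₁.1.label G.baseArc = u₂.1.label H.baseArc) :
    G.leeCoord₂ H (G.splitMap H hG hH 0 1 0 0 0 z) u₁ u₂ =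
      2 * (G.connSum H).leeCoord 0 z (glue₀ hG hH u₁ u₂ hb) := by
  rw [leeCoord₂_splitMap, dif_pos hb]

end LeeCoord

/-! ## Lee's canonical generators under the split map (Rasmussen's Prop. 4.1) -/

section Canonical

/-- **The split map comultiplies dual Lee generators diagonally.** For degree-zero enhanced states
`u₁` of `G` and `u₂` of `H` with the same label on the base arcs,
`Δ(ŝ_{glue u₁ u₂}) = 2 · ŝ_{u₁} ⊗ ŝ_{u₂}` exactly, where `ŝ_u = (leeCoord 0)⁻¹ e_u` and the elementary
tensor is the coefficient function `(s₁, s₂) ↦ ŝ_{u₁}(s₁) ŝ_{u₂}(s₂)`: both sides have the same Lee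
coordinates on pairs (`leeCoord₂_splitMap`, gluing being injective) and `leeCoord₂` is faithful.
The scalar `2` is `Δ 𝐚 = 𝐚 ⊗ 𝐚` read in dual coordinates (`⟨𝐚, 𝐚⟩ = 2`). [cite: Rasmussen2010, Prop. 4.1] -/
theorem splitMap_leeCoord_symm_single (u₁ : G.degStates 0) (u₂ : H.degStates 0)
    (hb : u₁.1.label G.baseArc = u₂.1.label H.baseArc) :
    G.splitMap H hG hH 0 1 0 0 0 (((G.connSum H).leeCoord 0).symm (Pi.single (glue₀ hG hH u₁ u₂ hb) 1)) =
      (2 : ℚ) • fun s₁ s₂ ↦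
        (G.leeCoord 0).symm (Pi.single u₁ 1) s₁ * (H.leeCoord 0).symm (Pi.single u₂ 1) s₂ := by
  apply G.leeCoord₂_injective H
  funext v₁ v₂
  rw [leeCoord₂_splitMap, map_smul, Pi.smul_apply, Pi.smul_apply, smul_eq_mul, leeCoord₂_tmul,
    LinearEquiv.apply_symm_apply, LinearEquiv.apply_symm_apply, LinearEquiv.apply_symm_apply]
  by_cases hb' : v₁.1.label G.baseArc = v₂.1.label H.baseArc
  · rw [dif_pos hb']
    by_cases hv : v₁ = u₁ ∧ v₂ = u₂
    · obtain ⟨rfl, rfl⟩ := hv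
      simp only [Pi.single_eq_same, mul_one]
    · have hne : glue₀ hG hH v₁ v₂ hb' ≠ glue₀ hG hH u₁ u₂ hb := fun heq ↦
        hv (eq_of_glue₀_eq_glue₀ hG hH heq)
      rw [Pi.single_eq_of_ne hne, mul_zero]
      rcases not_and_or.1 hv with h₁ | h₂
      · rw [Pi.single_eq_of_ne h₁, zero_mul, mul_zero]
      · rw [Pi.single_eq_of_ne h₂, mul_zero, mul_zero]
  · rw [dif_neg hb']
    by_cases h₁ : v₁ = u₁
    · subst h₁
      have h₂ : v₂ ≠ u₂ := by
        rintro rfl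
        exact hb' hb
      rw [Pi.single_eq_of_ne h₂, mul_zero, mul_zero]
    · rw [Pi.single_eq_of_ne h₁, zero_mul, mul_zero]

/-- **`Δ` kills, in degrees `(0, 0)`, the dual generators which are not glued from degree-zero
states** (their Lee coordinates on pairs all vanish). [cite: Rasmussen2010, Prop. 4.1] -/
theorem splitMap_leeCoord_symm_single_eq_zero (u : (G.connSum H).degStates 0)
    (hu : ¬ ∃ (u₁ : G.degStates 0) (u₂ : H.degStates 0)
      (hb : u₁.1.label G.baseArc = u₂.1.label H.baseArc), u = glue₀ hG hH u₁ u₂ hb) :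
    G.splitMap H hG hH 0 1 0 0 0 (((G.connSum H).leeCoord 0).symm (Pi.single u 1)) = 0 := by
  apply G.leeCoord₂_injective H
  funext v₁ v₂
  rw [leeCoord₂_splitMap, map_zero]
  split_ifs with hb
  · rw [LinearEquiv.apply_symm_apply, Pi.single_eq_of_ne, mul_zero]
    · rfl
    · intro heq
      exact hu ⟨v₁, v₂, hb, heq.symm⟩
  · rfl

/-- **The split map on Lee's monomials, Lee's normalisation**: for Lee's monomials
`𝐬_u = leeBasis 0 e_u` (products of `𝐚 = X + 𝟙`, `𝐛 = X - 𝟙` over the circles),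
`Δ(𝐬_{glue u₁ u₂}) = 𝐬_{u₁} ⊗ 𝐬_{u₂}` on the nose — the structure constants `Δ 𝐚 = 𝐚 ⊗ 𝐚`,
`Δ 𝐛 = 𝐛 ⊗ 𝐛` (via `leeBasis_single` and `circleCount_connSum`: `#circles + 1` add up).
[cite: Lee2005, §4] -/
theorem splitMap_leeBasis_single (u₁ : G.degStates 0) (u₂ : H.degStates 0)
    (hb : u₁.1.label G.baseArc = u₂.1.label H.baseArc) :
    G.splitMap H hG hH 0 1 0 0 0 ((G.connSum H).leeBasis 0 (Pi.single (glue₀ hG hH u₁ u₂ hb) 1)) =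
      fun s₁ s₂ ↦ G.leeBasis 0 (Pi.single u₁ 1) s₁ * H.leeBasis 0 (Pi.single u₂ 1) s₂ := by
  rw [leeBasis_single, leeBasis_single, leeBasis_single, map_smul,
    G.splitMap_leeCoord_symm_single H hG hH u₁ u₂ hb, smul_smul]
  have hc : (2 : ℚ) ^ (G.connSum H).circleCount (glue₀ hG hH u₁ u₂ hb).1.state * 2 =
      2 ^ G.circleCount u₁.1.state * 2 ^ H.circleCount u₂.1.state := by
    rw [← pow_succ]
    change (2 : ℚ) ^ ((G.connSum H).circleCount (Fin.append u₁.1.state u₂.1.state) + 1) = _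
    rw [G.circleCount_connSum H u₁.1.state u₂.1.state hG hH, pow_add]
  funext s₁ s₂
  simp only [Pi.smul_apply, smul_eq_mul]
  rw [hc]
  ring

/-- **Rasmussen's Prop. 4.1 for the split map, exact form.** For Lee's canonical states `𝔰_t` of
`G`, `H`, `G # H` (label `t` on arc `0`; dual generators `ŝ_t = (leeCoord 0)⁻¹ e_{𝔰_t}`):
`Δ(ŝ_t(G # H)) = 2 · ŝ_t(G) ⊗ ŝ_t(H)` — the saddle `D₁ # D₂ → D₁ ⊔ D₂` sends the canonical
generator to a *nonzero* multiple (`2`, for both `t`) of the tensor product of the canonical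
generators of the compatible orientations (the canonical states of `G # H` are glued from the
blocks', `leeState₀_connSum`). [cite: Rasmussen2010, Prop. 4.1] -/
theorem splitMap_leeState₀ (hpG : ∀ i, (G.overPos i).val % 2 ≠ (G.underPos i).val % 2)
    (hpH : ∀ j, (H.overPos j).val % 2 ≠ (H.underPos j).val % 2)
    (hpD : ∀ k, ((G.connSum H).overPos k).val % 2 ≠ ((G.connSum H).underPos k).val % 2) (t : Bool) :
    G.splitMap H hG hH 0 1 0 0 0
        (((G.connSum H).leeCoord 0).symm (Pi.single ((G.connSum H).leeState₀ hpD t) 1)) =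
      (2 : ℚ) • fun s₁ s₂ ↦ (G.leeCoord 0).symm (Pi.single (G.leeState₀ hpG t) 1) s₁ *
        (H.leeCoord 0).symm (Pi.single (H.leeState₀ hpH t) 1) s₂ := by
  rw [G.leeState₀_connSum H hG hH hpG hpH hpD t]
  exact G.splitMap_leeCoord_symm_single H hG hH _ _ _

/-- **Prop. 4.1 in Lee's normalisation**: for Lee's canonical generators `𝐬_t = leeBasis 0 e_{𝔰_t}`
themselves, `Δ(𝐬_t(G # H)) = 𝐬_t(G) ⊗ 𝐬_t(H)` exactly (`Δ 𝐚 = 𝐚 ⊗ 𝐚`, `Δ 𝐛 = 𝐛 ⊗ 𝐛` on the glued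
base circle). [cite: Rasmussen2010, Prop. 4.1] -/
theorem splitMap_leeBasis_leeState₀ (hpG : ∀ i, (G.overPos i).val % 2 ≠ (G.underPos i).val % 2)
    (hpH : ∀ j, (H.overPos j).val % 2 ≠ (H.underPos j).val % 2)
    (hpD : ∀ k, ((G.connSum H).overPos k).val % 2 ≠ ((G.connSum H).underPos k).val % 2) (t : Bool) :
    G.splitMap H hG hH 0 1 0 0 0 ((G.connSum H).leeBasis 0 (Pi.single ((G.connSum H).leeState₀ hpD t) 1)) =
      fun s₁ s₂ ↦ G.leeBasis 0 (Pi.single (G.leeState₀ hpG t) 1) s₁ *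
        H.leeBasis 0 (Pi.single (H.leeState₀ hpH t) 1) s₂ := by
  rw [G.leeState₀_connSum H hG hH hpG hpH hpD t]
  exact G.splitMap_leeBasis_single H hG hH _ _ _

/-- **The Lee coordinates of `Δ z` at the pair of canonical monomials** are twice the canonical
coordinate of `z`: `⟨Δ z, 𝔰_t(G) ⊗ 𝔰_t(H)⟩ = 2 ⟨z, 𝔰_t(G # H)⟩`. In particular a degree-zero Lee cycle
of `G # H` with a nonzero canonical coordinate is sent by `Δ` to a chain with a nonzero canonical
pair coordinate (the step "Prop. 4.1 ⇒ `Δ[z] ≠ 0`" of Rasmussen's proof of Prop. 3.11).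
[cite: Rasmussen2010, Prop. 4.1] -/
theorem leeCoord₂_splitMap_leeState₀ (hpG : ∀ i, (G.overPos i).val % 2 ≠ (G.underPos i).val % 2)
    (hpH : ∀ j, (H.overPos j).val % 2 ≠ (H.underPos j).val % 2)
    (hpD : ∀ k, ((G.connSum H).overPos k).val % 2 ≠ ((G.connSum H).underPos k).val % 2) (t : Bool)
    (z : (G.connSum H).degStates 0 → ℚ) :
    G.leeCoord₂ H (G.splitMap H hG hH 0 1 0 0 0 z) (G.leeState₀ hpG t) (H.leeState₀ hpH t) =
      2 * (G.connSum H).leeCoord 0 z ((G.connSum H).leeState₀ hpD t) := by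
  rw [G.leeCoord₂_splitMap_of_eq H hG hH z _ _ (G.leeState_label_baseArc H hG hH hpG hpH t),
    G.leeState₀_connSum H hG hH hpG hpH hpD t]

end Canonical

end GaussDiagram

end Literature.Topology.FourManifolds
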